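import Summits.BirchSwinnertonDyer.Rank1Residual.Additive.RamifiedSevenIntegralComparisonOfInputsR
import HarnessLib

set_option autoImplicit false

/-!
# K2C-9R — `KatoExpPadicDatum hγ Φ`: the re-typed dual-exponential value datum WITH 7-ADIC ★-CONSTANTS
# `(α₀, α₁) ∈ ℤ₇² ∖ {0}`, and block (R) ★/★′, (KI)-R ★, (PK)-R ★″ re-derived over it — DRAFT-OF-RECORD

DRAFT-OF-RECORD for row K2C-9R (pen D1085 (III) «KatoExpDatum v2 (α₀ α₁ : ℤ_[7]) NEW Additive file + block (R)/(KI)-R/K2ᶜ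
assembly re-derived + ★″ ports»; GO = pen D1086 (II) 2026-08-31T06:45:43Z with conditions (c1)–(c4), ACKed 06:48:47Z).
Cell bsd-cm, seat bsd-idea-20 g80 (planner, crux-level, W-71 no births, W-79 publish-only), crux `EllipticUnitValueSevenOfGZK`
(stmt-BirchSwinnertonDyer-19945, route K7r `RamifiedSevenEllipticUnits`; line of record = pen's zp v17
`Lines/kato_perrin_riou_zp.lean` ec08528542ba2d3f, untouched).  Tree files never import `Cruxes/`; the PORT is the typer's.
WHY (pen D1085 (ρ1), hazard (H-γ) of `StarValuePin_g79.md` REV 1.1 §8): Kato's constant of (15.16.1) for the `Λˣ`-normalised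
★-class lives in `(O_K ⊗ ℤ₇) ∖ {0} = ℤ₇ ⊕ ℤ₇√−7 ∖ {0}`, not in `O_K`; the tree's `KatoExpDatum.α₀ α₁ : ℤ` over-types it.  This
file re-types the pair 7-adically and shows that NOTHING downstream is lost: block (R) and its corollaries go through with
the same binders and the SAME conclusions, the period-position exponent becoming `jα = v₇(α₀² + 7α₁²)`.

PORT PLAN (typer; nothing else changes): namespace `Summit.BirchSwinnertonDyer.Rank1Residual.Additive.GenusSeven` (drop the
`K2C9R` Cruxes namespace and the `dupNamespace` option), split at the `## §…` section headers into files < 400 l.: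
§A+§B ↦ `Additive/RamifiedSevenRationalComparisonAlgebraPadic.lean` (kernels; §A is Mathlib-only, §B abstract algebra),
§C+§D ↦ `Additive/RamifiedSevenGenusKatoExpPadicDatum.lean`, §E ↦ `Additive/RamifiedSevenRationalComparisonOfPadicInputsR.lean`,
§F+§G ↦ `Additive/RamifiedSevenIntegralComparisonOfPadicInputsR.lean`.  On port the `_C` suffixes of §B may be dropped only
if the v1 kernels of `RamifiedSevenRationalComparisonAlgebra.lean` are not in scope (they share the short names).

WHAT THIS FILE DOES (67 declarations: 1 structure, 8 defs — exactly ONE `def … : Prop`, `KatoExpPadicCompatShape`, the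
successor of the tree's `KatoExpCompatShape` —, 58 theorems, 1 junction `example`; axioms of every theorem ⊆ {propext,
Classical.choice, Quot.sound}; farm rc 0, 0 sorry, 0 warning):
§A 7-ADIC KERNELS (Mathlib-only; re-proved from the seat's g79 workfile `EZConstantPadic_g79.lean`, not importable):
  `normSeven_eq_zero_iff` (`x² + 7y²` anisotropic over `ℤ₇`, descent on `v₇`), `normSeven_ne_zero`,
  `eq_unitCoeff_mul_pow_valuation`/`pow_valuation_dvd` (normal form `x = w·7^{v(x)}` through Mathlib `PadicInt.unitCoeff`,
  `PadicInt.valuation : ℤ_[p] → ℕ`), `isUnit_two_padicInt`, the DESCENT `pow_dvd_map_sub_map_mul` (`7^j ∣ α₀² + 7α₁² ⟹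
  π^j ∣ φ α₀ − φ α₁·π` for any ring map `φ : ℤ₇ → R`, `7 = v·π²`; the 7-adic currency of the tree's
  `PeriodPosition.pow_dvd_intCast_sub_intCast_mul`), the D916 shape `pow_dvd_const_mul_of_le` and `pow_dvd_constZ_mul_of_le`,
  and the READING: `padic_sq_ne_neg_seven` (`−7 ∉ (ℚ₇)²`, valuation parity), `padicReading_eq_zero_iff`/`padicReading_ne_zero`
  (`ι a + ι b·s = 0 ↔ a = b = 0` for `ι : ℚ₇ →+* ℂ`, `s² = −7`) — the (H-γ)-compatible replacement of
  `PinnedKatoGenusFrame.intCast_add_mul_sqrt_ne_zero`.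
§B BLOCK (A) KERNELS WITH `Λ`-VALUED ★-COEFFICIENTS `A₀ A₁ : Λ` read in `ℂ` by `a₀ a₁` through two value laws
  (`hA₀ : val (A₀ • m) = a₀·val m`, `hA₁`): `r_eq_zero_of_s_eq_zero_C`, `module_identity_C`, `key_complex_identity_C`,
  `ev_normForm_eq_zero_C` — the tree's `r_eq_zero_of_s_eq_zero`, `module_identity`, `key_complex_identity`,
  `ev_normForm_eq_zero` (`RamifiedSevenRationalComparisonAlgebra.lean`) with `(α_i : ℤ) ↦ A_i`, `(α_i : ℂ) ↦ a_i`, same proofs.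
§C THE DATUM `KatoExpPadicDatum hγ Φ` (c1) + `KatoExpPadicCompatShape` (:= `Nonempty`) + `katoExpPadicCompatShape_iff` +
  the datum-free `ne_zero_of_padicValueLaw` (successor of `PinnedKatoGenusFrame.ne_zero_of_valueLaw`) + the §2 API of
  `RamifiedSevenGenusKatoExpDatum.lean` re-issued VERBATIM in `namespace KatoExpPadicDatum` (`val_smul_piK`, `val_intCast_smul`,
  NEW `val_algebraMap_smul` (`algebraMap ℤ₇ Λ = PowerSeries.C`), `sigma`, `sigma_def`, `exists_nat_toZModPow_artExp`,
  `inv_heckeIdealValue_eq_pow`, `val_sigma_smul_eq_pow`, ★ eigen-lemma `val_sigma_smul`, `charEval_sigma`, `val_zStar_ne_zero`).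
§D THE EXPLICIT DATA of block (R), 7-adic currency: `xTilde`/`xTilde_def` VERBATIM; `cZ := (A(C α₀) − A(C α₁)·π)·A((7^e : ℤ))·
  (A(uStar⁻¹)·(A(7^k)·(u·π^a)))` (`A = algebraMap Λ Λ_O`, `C = PowerSeries.C : ℤ₇ →+* Λ`; (c4): the pair enters ONLY through
  `algebraMap ∘ C`, no `ι₇`); `normA : ℤ_[7] := α₀² + 7α₁²`, `normA_ne_zero`; `jα : ℕ := D.normA.valuation` ((c4), Mathlib
  `PadicInt.valuation (x : ℤ_[p]) : ℕ := (x : ℚ_[p]).valuation.toNat`, `Mathlib/NumberTheory/Padics/PadicIntegers.lean`);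
  `normUnit := PadicInt.unitCoeff _ : ℤ_[7]ˣ`, `normA_eq_normUnit_mul_pow`, `seven_pow_jα_dvd_normA`; `wα := v^{jα}·A(2·C normUnit)`,
  `isUnit_wα`; `C_two_mul_normA`, `sTwoSided_eq` (`π^{m₀}·A(C(2N(α))) = wα·π^{m₀+2jα}`), `C_sq_add_seven_mul_C_sq_ne_zero`,
  `two_mul_C_sq_add_eq`, `cZ_eq`, and (PK)-R's `pow_dvd_cZ_mul_of_leAt`/`pow_dvd_cZ_mul_of_le` (same letters as the tree's).
§E BLOCK (R) over the padic datum, SAME binders (ht′) (tf) (rk) hχ hL (r5′) as the tree's ★: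
  ★ `twoSidedComparisonShape_of_katoExpPadicDatum : … TwoSidedComparisonShape Φ D.xTilde (π^{m₀}·A(C(2(α₀²+7α₁²)))) (D.cZ·t′)`
  (the v1 proof STEP 1/1′/2/3 with `A_i := C α_i` opaque, readings `hA_i` from (e1′) `val_C`, `hZ` from (eZ′), `hVZ` from
  `val_zStar_ne_zero`, the `_C` kernels, and the last line `rw [← two_mul_C_sq_add_eq]`), ★′
  `periodScaledComparisonShape_of_katoExpPadicDatum` (exponent `m₀ + 2·D.jα`, constant `wα⁻¹·(D.cZ·t′)`),
  `rationalComparisonShape_of_katoExpPadicCompat`.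
§F (KI)-R: `integralComparisonShape_of_katoExpPadicDatum` (+ `_of_le`, `_of_leAt`: `PeriodPositionField(At)` UNFOLDED, (c3)),
  ★ `integralComparisonSeven_of_katoExpPadicInputs` — (c2): the statement of the tree's
  `GenusSeven.integralComparisonSeven_of_katoExpInputs` (`RamifiedSevenIntegralComparisonOfInputsR.lean`, p801395) with
  `KatoExpDatum ↦ KatoExpPadicDatum` in `h` and the SAME conclusion (mechanical `diff` of the two statement texts: 2 lines —
  the theorem name and `∃ D : KatoExpPadicDatum hγ Φ`), the JUNCTION `example` (both input forms land in one and the same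
  written conclusion, proved `⟨★ h, GenusSeven.integralComparisonSeven_of_katoExpInputs hv1⟩` — the kernel certifies the two
  conclusion types coincide), `k2cPinned_of_katoExpPadicInputs`, `k2cPinned_of_katoExpPadicCompat_of_divisibility`.
§G (PK)-R: ★″ `integralComparisonSeven_of_katoExpPadicPeriodPositionInputs` — (c3): the tree's ★″ with `KatoExpDatum ↦
  KatoExpPadicDatum`, last conjunct `IsUnit Φ.t ∧ D.jα ≤ 2 * D.e + 2 * Φ.k + Φ.a`, SAME conclusion (text `diff`: 2 lines, as
  above); ★″-At `integralComparisonSeven_of_katoExpPadicPeriodPositionAtInputs` (general gauge `t′ = w′·π^{m′}`).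

PEN CONDITIONS D1086 (II):
  (c1) NAME `KatoExpPadicDatum`; fields LETTER-IDENTICAL to `KatoExpDatum` (`RamifiedSevenGenusKatoExpDatum.lean` :130–199)
       except `α₀ : ℤ_[7]`, `α₁ : ℤ_[7]` and (eZ′) `val_zStar`'s right side `(ι₇ (α₀ : ℚ_[7]) + ι₇ (α₁ : ℚ_[7]) * Φ.ιC(√−7)) *
       Φ.Ω⁻¹ * Lf 1`; `α_ne_zero : α₀ ≠ 0 ∨ α₁ ≠ 0` keeps its letter at the new type — CHECKED by a docstring-stripped `diff`
       of the two structure texts (3 hunks: name; the two field types; the (eZ′) right side).  MET.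
  (c2) ★ = tree statement under `KatoExpDatum ↦ KatoExpPadicDatum`, same conclusion, junction `example` — MET (§F).
  (c3) ★″ over the padic datum, same conclusion, last conjunct `IsUnit Φ.t ∧ D.jα ≤ 2 * D.e + 2 * Φ.k + Φ.a`;
       `PeriodPositionField(At)` unfolded — MET (§G).
  (c4) `jα : ℕ := D.normA.valuation` (Mathlib `PadicInt.valuation : ℤ_[p] → ℕ`, stated in `jα`'s docstring); `cZ`'s constants
       enter only through `algebraMap` (`algebraMap Λ Λ_O (PowerSeries.C α_i)`), no `ι₇` inside `cZ` — MET (§D).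
DEVIATIONS FROM v1 BEYOND (c1) (all forced by the currency change; listed per (c1) «any further deviation explicitly»):
  (d1) data: `cZ` reads `C α_i` (v1 `(α_i : Λ)`), `normA : ℤ_[7]` (v1 `ℕ`, `natAbs`), `jα := normA.valuation` (v1
       `normA.factorization 7`), `normUnit`/`wα` through `PadicInt.unitCoeff` (v1 `(2·(normA / 7^jα) : ℕ)`); ★'s LEFT constant is
       `π^{m₀}·A(PowerSeries.C (2·(α₀² + 7α₁²)))` (v1 `π^{m₀}·A(((2·(α₀² + 7α₁²)) : ℤ))`) — the closest letter: compute in the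
       coefficient ring, then map; ★′/(KI)-R/★″ letters are then IDENTICAL to v1's (`m₀ + 2 * D.jα`, `wα⁻¹·(D.cZ·t′)`).
  (d2) kernels: §B `_C` generalisations (ℤ-casts ↦ `Λ`-elements + readings); §A `pow_dvd_map_sub_map_mul` (7-adic descent needs
       `Prime (7 : ℤ_[7])` in place of `Int` arithmetic); `ne_zero_of_padicValueLaw` needs `−7 ∉ (ℚ₇)²` in place of `√−7 ∉ ℚ`.
  (d3) NOT in this file (follow-on rows, not GO'd here): the padic successors of the CONSTRUCTORS `KatoExpDatum.ofLaws` /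
       `ofLawsOfGenerators` (`RamifiedSevenGenusKatoExpDatumOfLaws.lean`; their `(α₀ α₁ : ℤ)` binders in `hZ` become `ℤ_[7]`
       and `hα` unchanged), and the `PeriodPositionField(At)` predicates over the padic datum (kept unfolded per (c3)).
  (d4) binder `[Fact (Nat.Prime 7)]` on the §A kernels (the `ℤ_[7]` API wants it; the Frame sections carry it already, as v1).

FINDINGS (boxed for the pen; none is a letter deviation):
  ┌ (F1) NO LOSS.  Every v1 theorem of block (R)/(KI)-R/(PK)-R has its padic twin here with the same binders and the same
  │      conclusion; the only consumer-visible change is the TYPE of `D` (and that `jα` is a 7-adic valuation).  The zp v17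
  │      touch can be re-pointed by the substitution `KatoExpDatum ↦ KatoExpPadicDatum` alone (junction `example`, §F).
  │ (F2) THE READING IS INJECTIVE FOR A REASON ONE LEVEL UP: v1 used `√−7 ∉ ℚ` (`intCast_add_mul_sqrt_ne_zero`); the padic
  │      datum needs `−7 ∉ (ℚ₇)²` (`padic_sq_ne_neg_seven`, `v₇(x²)` even vs `v₇(−7) = 1`) so that `ι₇(ℚ₇) ∌ ιC(√−7)`:
  │      `7` RAMIFIES in `K = ℚ(√−7)`, which is exactly why `K ⊗ ℚ₇` is a field and the pair `(ι₇ α₀, ι₇ α₁)` is read faithfully.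
  │ (F3) `x² + 7y²` ANISOTROPIC over `ℤ₇` (descent) replaces positivity of `α₀² + 7α₁² ∈ ℕ`; `N(α) ≠ 0` then gives
  │      `jα < ∞` and `(C α₀)² + 7(C α₁)² ≠ 0` in the domain `Λ` for STEP 2.
  │ (F4) `PowerSeries.C` has its coefficient ring IMPLICIT in this toolchain: write `PowerSeries.C (R := ℤ_[7])` where the
  │      ring is not inferable (`isUnit_wα`, `C_sq_add_seven_mul_C_sq_ne_zero`, `pow_dvd_cZ_mul_of_leAt`).
  └ (F5) (PK)-R exponent: with `jα = v₇(N(α))` the pre-registered prediction «EQUALITY `jα = 2e + 2k + a` on genuine data»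
         (tree ★″ docstring) keeps its meaning verbatim; `hPP` is the inequality half.

HONEST LABEL: infrastructure (a hypothesis structure, definitions, kernel lemmas, conditional implications); it closes no
item, registers no stub, proves no summit statement; every ★/★′/★″ is CONDITIONAL on its displayed binders; nothing is
asserted to exist; stmt-BirchSwinnertonDyer-19945 is OPEN; `X12.CMRamifiedSeven` is NOT proved; BSD is claimed for no curve.
No `sorry`, no `instance`, no `notation`/`macro`, no named fact introduced, no attribute removed.

References: [Kato2004Asterisque] K. Kato, p-adic Hodge theory and values of zeta functions of modular forms, Astérisque 295
(2004): Thm. 12.4 (2) / 12.5 (1) (p. 221), 13.5 (p. 227), §13.9 (p. 230), Prop. 15.9 (15.9.1) (pp. 258–259), (15.12.2)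
(p. 263), 15.14 (p. 264), §15.16 (15.16.1) (p. 265); [BlochKato1990] S. Bloch, K. Kato, L-functions and Tamagawa numbers of
motives, Def. 3.10, Ex. 3.10.1–3.11 (pp. 359–361); [Washington1997] L. Washington, Introduction to Cyclotomic Fields, §7.1
(Prop. 7.2), §13.2; [NeukirchSchmidtWingberg2008] J. Neukirch, A. Schmidt, K. Wingberg, Cohomology of Number Fields, XI §1–§2;
[Serre1973] J.-P. Serre, A Course in Arithmetic, Ch. II §2 (squares in `ℚ_p`: `−7 ∉ (ℚ₇)²`).
-/

noncomputable section

set_option linter.dupNamespace false -- (the `Cruxes/` namespace repeats `BirchSwinnertonDyer`; drop on port)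

open scoped NumberField TensorProduct
open Field IsDedekindDomain NumberField Polynomial
open Literature.NumberTheory.GaloisRepresentations
open Literature.NumberTheory.EllipticCurves
open Literature.NumberTheory.EllipticCurves.Rank1Residual
open Literature.NumberTheory.EllipticCurves.IwasawaAlgebra
open Literature.NumberTheory.EllipticCurves.Kato2004
open Literature.NumberTheory.ComplexMultiplication.EllipticUnits
open Summit.BirchSwinnertonDyer.Rank1Residual
open Summit.BirchSwinnertonDyer.Rank1Residual.Additive
open Summit.BirchSwinnertonDyer.Rank1Residual.Additive.GenusSeven

namespace Summit.BirchSwinnertonDyer.BirchSwinnertonDyer.Cruxes.EllipticUnitValueSevenOfGZK.K2C9R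

/-! ## §A  7-adic kernels: anisotropy of `x² + 7y²` over `ℤ₇`, the normal form `N = w·7^{v(N)}`, the descent
`7^j ∣ α₀² + 7α₁² ⟹ π^j ∣ φ α₀ − φ α₁·π`, the D916 divisibility shape, and the injective reading `ℚ₇ ⊕ ℚ₇√−7 → ℂ`
(re-proved from the seat's workfile `EZConstantPadic_g79.lean` (HOME g79/, sha16 85212f38278320e8) — workfiles are not importable) -/

section Padic

variable [Fact (Nat.Prime 7)]

/-- `7` is prime in `ℤ₇`. [folklore] -/
theorem prime_seven_padicInt : Prime (7 : ℤ_[7]) := by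
  simpa using (PadicInt.prime_p (p := 7))

/-- `7 ≠ 0` in `ℤ₇`. [folklore] -/
theorem seven_ne_zero_padicInt : (7 : ℤ_[7]) ≠ 0 := prime_seven_padicInt.ne_zero

/-- `v(7·x) = 1 + v(x)` for `x ≠ 0`. [folklore] -/
theorem valuation_seven_mul {x : ℤ_[7]} (hx : x ≠ 0) : ((7 : ℤ_[7]) * x).valuation = 1 + x.valuation := by
  rw [PadicInt.valuation_mul seven_ne_zero_padicInt hx]
  simpa using (PadicInt.valuation_p (p := 7))

/-- One descent step: a solution of `a² + 7b² = 0` in `ℤ₇` is `7`·(a solution). [folklore] -/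
theorem normSeven_descent {a b : ℤ_[7]} (h : a ^ 2 + 7 * b ^ 2 = 0) :
    ∃ a' b' : ℤ_[7], a = 7 * a' ∧ b = 7 * b' ∧ a' ^ 2 + 7 * b' ^ 2 = 0 := by
  have h7a2 : (7 : ℤ_[7]) ∣ a ^ 2 := ⟨-b ^ 2, by linear_combination h⟩
  obtain ⟨a', rfl⟩ := prime_seven_padicInt.dvd_of_dvd_pow h7a2
  have h' : (7 : ℤ_[7]) * (7 * a' ^ 2 + b ^ 2) = 7 * 0 := by linear_combination h
  have h'' : 7 * a' ^ 2 + b ^ 2 = 0 := mul_left_cancel₀ seven_ne_zero_padicInt h'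
  have h7b2 : (7 : ℤ_[7]) ∣ b ^ 2 := ⟨-a' ^ 2, by linear_combination h''⟩
  obtain ⟨b', rfl⟩ := prime_seven_padicInt.dvd_of_dvd_pow h7b2
  refine ⟨a', b', rfl, rfl, ?_⟩
  have h3 : (7 : ℤ_[7]) * (a' ^ 2 + 7 * b' ^ 2) = 7 * 0 := by linear_combination h''
  exact mul_left_cancel₀ seven_ne_zero_padicInt h3

/-- **`x² + 7y²` is anisotropic over `ℤ₇`**: `a² + 7b² = 0 ↔ a = 0 ∧ b = 0` (descent on `v(a)`). [folklore] -/
theorem normSeven_eq_zero_iff (a b : ℤ_[7]) : a ^ 2 + 7 * b ^ 2 = 0 ↔ a = 0 ∧ b = 0 := by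
  constructor
  · intro h
    suffices ha : a = 0 by
      subst ha
      have : (7 : ℤ_[7]) * b ^ 2 = 0 := by simpa using h
      rcases mul_eq_zero.mp this with h7 | hb
      · exact absurd h7 seven_ne_zero_padicInt
      · exact ⟨rfl, pow_eq_zero_iff (n := 2) (by norm_num) |>.mp hb⟩
    by_contra ha
    have key : ∀ n : ℕ, ∀ a b : ℤ_[7], a ≠ 0 → a.valuation = n → a ^ 2 + 7 * b ^ 2 = 0 → False := by
      intro n
      induction n using Nat.strong_induction_on with
      | _ n ih =>
        intro a b ha hn h
        obtain ⟨a', b', rfl, rfl, h'⟩ := normSeven_descent h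
        have ha' : a' ≠ 0 := by
          rintro rfl
          exact ha (by simp)
        have hv : (7 * a').valuation = 1 + a'.valuation := valuation_seven_mul ha'
        exact ih a'.valuation (by omega) a' b' ha' rfl h'
    exact key a.valuation a b ha rfl h
  · rintro ⟨rfl, rfl⟩
    simp

/-- `(α₀, α₁) ≠ 0 ⟹ α₀² + 7α₁² ≠ 0` in `ℤ₇`. [cite: Kato2004Asterisque, (15.16.1) (p. 265)] -/
theorem normSeven_ne_zero {α₀ α₁ : ℤ_[7]} (h : α₀ ≠ 0 ∨ α₁ ≠ 0) : α₀ ^ 2 + 7 * α₁ ^ 2 ≠ 0 := by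
  intro h0
  obtain ⟨h1, h2⟩ := (normSeven_eq_zero_iff α₀ α₁).mp h0
  rcases h with h | h
  · exact h h1
  · exact h h2

/-- **Normal form**: a non-zero `x ∈ ℤ₇` is `w·7^{v(x)}` with `w = PadicInt.unitCoeff` a unit; `PadicInt.valuation : ℤ_[p] → ℕ`.
[folklore] -/
theorem eq_unitCoeff_mul_pow_valuation {x : ℤ_[7]} (hx : x ≠ 0) :
    x = (PadicInt.unitCoeff hx : ℤ_[7]) * 7 ^ x.valuation := by
  simpa using PadicInt.unitCoeff_spec hx

/-- `7^{v(x)} ∣ x`. [folklore] -/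
theorem pow_valuation_dvd {x : ℤ_[7]} (hx : x ≠ 0) : (7 : ℤ_[7]) ^ x.valuation ∣ x :=
  ⟨PadicInt.unitCoeff hx, by rw [mul_comm]; exact eq_unitCoeff_mul_pow_valuation hx⟩

/-- The integers prime to `7` are units of `ℤ₇`. [folklore] -/
theorem isUnit_intCast_padicInt_of_not_dvd {k : ℤ} (hk : ¬ (7 : ℤ) ∣ k) : IsUnit ((k : ℤ_[7])) := by
  rw [PadicInt.isUnit_iff]
  have hle := PadicInt.norm_le_one ((k : ℤ_[7]))
  have hlt : ¬ ‖((k : ℤ_[7]))‖ < 1 := by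
    rw [PadicInt.norm_int_lt_one_iff_dvd]; exact_mod_cast hk
  exact le_antisymm hle (not_lt.mp hlt)

/-- `2` is a unit of `ℤ₇`. [folklore] -/
theorem isUnit_two_padicInt : IsUnit (2 : ℤ_[7]) := by
  have h := isUnit_intCast_padicInt_of_not_dvd (k := 2) (by decide)
  simpa using h

section Kernel

variable {R : Type*} [CommRing R]

/-- **`π^j ∣ φ α₀ − φ α₁·π` whenever `7^j ∣ α₀² + 7α₁²` (`α₀, α₁ ∈ ℤ₇`)**, for any ring map `φ : ℤ₇ → R` into a commutative
ring with `7 = v·π²` — the 7-adic currency of the tree's `PeriodPosition.pow_dvd_intCast_sub_intCast_mul` (same induction on `j`).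
[cite: Kato2004Asterisque, (15.16.1) (p. 265)] -/
theorem pow_dvd_map_sub_map_mul (φ : ℤ_[7] →+* R) (π v : R) (h7 : (7 : R) = v * π ^ 2) :
    ∀ (j : ℕ) (α₀ α₁ : ℤ_[7]), (7 : ℤ_[7]) ^ j ∣ α₀ ^ 2 + 7 * α₁ ^ 2 → π ^ j ∣ (φ α₀ - φ α₁ * π) := by
  intro j
  induction j using Nat.strong_induction_on with
  | _ j ih =>
    intro α₀ α₁ hdvd
    match j, ih, hdvd with
    | 0, _, _ => exact ⟨φ α₀ - φ α₁ * π, by ring⟩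
    | 1, _, hdvd =>
      have h7N : (7 : ℤ_[7]) ∣ α₀ ^ 2 + 7 * α₁ ^ 2 := by simpa using hdvd
      have h7a : (7 : ℤ_[7]) ∣ α₀ ^ 2 := (dvd_add_left (dvd_mul_right (7 : ℤ_[7]) (α₁ ^ 2))).mp h7N
      obtain ⟨a, rfl⟩ := prime_seven_padicInt.dvd_of_dvd_pow h7a
      refine ⟨v * π * φ a - φ α₁, ?_⟩
      rw [map_mul, map_ofNat, h7]
      ring
    | j + 2, ih, hdvd =>
      have h7N : (7 : ℤ_[7]) ∣ α₀ ^ 2 + 7 * α₁ ^ 2 :=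
        (dvd_pow_self (7 : ℤ_[7]) (by omega : j + 2 ≠ 0)).trans hdvd
      have h7a : (7 : ℤ_[7]) ∣ α₀ ^ 2 := (dvd_add_left (dvd_mul_right (7 : ℤ_[7]) (α₁ ^ 2))).mp h7N
      obtain ⟨a, rfl⟩ := prime_seven_padicInt.dvd_of_dvd_pow h7a
      have h49 : (7 : ℤ_[7]) ^ 2 ∣ (7 * a) ^ 2 + 7 * α₁ ^ 2 :=
        (pow_dvd_pow (7 : ℤ_[7]) (by omega : 2 ≤ j + 2)).trans hdvd
      have h49' : (7 : ℤ_[7]) * 7 ∣ 7 * α₁ ^ 2 := by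
        have h1 : (7 : ℤ_[7]) ^ 2 ∣ (7 * a) ^ 2 := ⟨a ^ 2, by ring⟩
        have h2 := (dvd_add_right h1).mp h49
        simpa [pow_two] using h2
      have h7b2 : (7 : ℤ_[7]) ∣ α₁ ^ 2 := (mul_dvd_mul_iff_left seven_ne_zero_padicInt).mp h49'
      obtain ⟨b, rfl⟩ := prime_seven_padicInt.dvd_of_dvd_pow h7b2
      have hj : (7 : ℤ_[7]) ^ j ∣ a ^ 2 + 7 * b ^ 2 := by
        have h1 : (7 : ℤ_[7]) ^ (j + 2) = 7 ^ 2 * 7 ^ j := by ring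
        have h2 : (7 * a) ^ 2 + 7 * (7 * b) ^ 2 = (7 : ℤ_[7]) ^ 2 * (a ^ 2 + 7 * b ^ 2) := by ring
        rw [h1, h2] at hdvd
        exact (mul_dvd_mul_iff_left (pow_ne_zero 2 seven_ne_zero_padicInt)).mp hdvd
      obtain ⟨c, hc⟩ := ih j (by omega) a b hj
      refine ⟨v * c, ?_⟩
      rw [map_mul, map_mul, map_ofNat]
      have h3 : (7 : R) * φ a - 7 * φ b * π = 7 * (φ a - φ b * π) := by ring
      rw [h3, hc, h7]
      ring

omit [Fact (Nat.Prime 7)] in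
/-- **The D916 divisibility SHAPE** (general `t`-gauge): if `π^j ∣ x` then
`m₀ + 2j ≤ j + (2e + 2k + a) + m′ ⟹ π^(m₀ + 2j) ∣ ((x·7^e)·(w·(7^k·(u·π^a))))·(w′·π^{m′})`, in any commutative ring with
`7 = v·π²`; no unit hypothesis on `v, w, u, w′`. [cite: Kato2004Asterisque, (15.16.1) (p. 265)] -/
theorem pow_dvd_const_mul_of_le (π v : R) (h7 : (7 : R) = v * π ^ 2) {x : R} {j : ℕ} (hx : π ^ j ∣ x)
    (e k a m₀ m' : ℕ) (w u w' : R) (hle : m₀ + 2 * j ≤ j + (2 * e + 2 * k + a) + m') :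
    π ^ (m₀ + 2 * j) ∣ ((x * (7 : R) ^ e) * (w * ((7 : R) ^ k * (u * π ^ a)))) * (w' * π ^ m') := by
  obtain ⟨c, hc⟩ := hx
  have hpow : π ^ (m₀ + 2 * j) ∣ π ^ (j + (2 * e + 2 * k + a) + m') := pow_dvd_pow π hle
  have hshape : ((x * (7 : R) ^ e) * (w * ((7 : R) ^ k * (u * π ^ a)))) * (w' * π ^ m') =
      π ^ (j + (2 * e + 2 * k + a) + m') * (c * v ^ e * w * v ^ k * u * w') := by
    rw [hc, h7]
    ring
  rw [hshape]
  exact hpow.mul_right _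

/-- **The D916 divisibility input from an integer inequality, 7-adic currency** (general `t`-gauge): with
`j := (α₀² + 7α₁²).valuation`, `cZ := (φ α₀ − φ α₁·π)·7^e·(w·(7^k·(u·π^a)))` and `t′ = w′·π^{m′}`:
`m₀ + 2j ≤ j + (2e + 2k + a) + m′ ⟹ π^(m₀ + 2j) ∣ cZ·t′`. [cite: Kato2004Asterisque, (15.16.1) (p. 265)] -/
theorem pow_dvd_constZ_mul_of_le (φ : ℤ_[7] →+* R) (π v : R) (h7 : (7 : R) = v * π ^ 2) (α₀ α₁ : ℤ_[7])
    (hα : α₀ ≠ 0 ∨ α₁ ≠ 0) (e k a m₀ m' : ℕ) (w u w' : R)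
    (hle : m₀ + 2 * (α₀ ^ 2 + 7 * α₁ ^ 2).valuation ≤
      (α₀ ^ 2 + 7 * α₁ ^ 2).valuation + (2 * e + 2 * k + a) + m') :
    π ^ (m₀ + 2 * (α₀ ^ 2 + 7 * α₁ ^ 2).valuation) ∣
      (((φ α₀ - φ α₁ * π) * (7 : R) ^ e) * (w * ((7 : R) ^ k * (u * π ^ a)))) * (w' * π ^ m') :=
  pow_dvd_const_mul_of_le π v h7
    (pow_dvd_map_sub_map_mul φ π v h7 _ α₀ α₁ (pow_valuation_dvd (normSeven_ne_zero hα))) e k a m₀ m' w u w' hle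

end Kernel

/-- `v(−1) = 0` in `ℚ₇`. [folklore] -/
theorem padicValuation_neg_one : (-1 : ℚ_[7]).valuation = 0 := by
  have h : (-1 : ℚ_[7]) * (-1) = 1 := by ring
  have hne : (-1 : ℚ_[7]) ≠ 0 := by norm_num
  have := Padic.valuation_mul hne hne
  rw [h, Padic.valuation_one] at this
  omega

/-- **`−7` is not a square in `ℚ₇`** (`v(x²)` is even, `v(−7) = 1`). [folklore] -/
theorem padic_sq_ne_neg_seven (x : ℚ_[7]) : x ^ 2 ≠ -7 := by
  intro hx
  have hx0 : x ≠ 0 := by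
    rintro rfl
    norm_num at hx
  have h2 : (x * x).valuation = x.valuation + x.valuation := Padic.valuation_mul hx0 hx0
  have h7 : ((-1 : ℚ_[7]) * 7).valuation = (-1 : ℚ_[7]).valuation + (7 : ℚ_[7]).valuation :=
    Padic.valuation_mul (by norm_num) (by exact_mod_cast (show (7 : ℕ) ≠ 0 by norm_num))
  have hp : (7 : ℚ_[7]).valuation = 1 := by exact_mod_cast (Padic.valuation_p (p := 7))
  have hxx : x * x = (-1 : ℚ_[7]) * 7 := by rw [← pow_two, hx]; ring
  rw [hxx, h7, padicValuation_neg_one, hp] at h2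
  omega

omit [Fact (Nat.Prime 7)] in
/-- **Injectivity of the reading `ℚ₇ ⊕ ℚ₇·s → ℂ`**: for a ring map `ι : ℚ₇ → ℂ` and `s ∈ ℂ` with `s² = −7`,
`ι a + ι b·s = 0 ↔ a = 0 ∧ b = 0` (`s ∈ ι(ℚ₇)` would make `−7` a square in `ℚ₇`). [cite: Kato2004Asterisque, Prop. 15.9 (pp. 258–259)] -/
theorem padicReading_eq_zero_iff [Fact (Nat.Prime 7)] (ι : ℚ_[7] →+* ℂ) (s : ℂ) (hs : s ^ 2 = -7) (a b : ℚ_[7]) :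
    ι a + ι b * s = 0 ↔ a = 0 ∧ b = 0 := by
  constructor
  · intro h
    by_cases hb : b = 0
    · subst hb
      have ha : ι a = 0 := by simpa using h
      exact ⟨(map_eq_zero_iff ι ι.injective).mp ha, rfl⟩
    · exfalso
      have hιb : ι b ≠ 0 := (map_ne_zero_iff ι ι.injective).mpr hb
      have hs' : s = ι (-a / b) := by
        rw [map_div₀, map_neg]
        field_simp
        linear_combination h
      have h7 : ι ((-a / b) ^ 2) = ι (-7) := by
        rw [map_pow, ← hs', hs, map_neg, map_ofNat]
      exact padic_sq_ne_neg_seven (-a / b) (ι.injective h7)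
  · rintro ⟨rfl, rfl⟩
    simp

/-- **The 7-adic reading of a non-zero pair is non-zero**: `(α₀, α₁) ≠ 0` in `ℤ₇` ⟹ `ι α₀ + ι α₁·s ≠ 0` for `s² = −7`.
[cite: Kato2004Asterisque, Prop. 15.9 (pp. 258–259)] -/
theorem padicReading_ne_zero (ι : ℚ_[7] →+* ℂ) (s : ℂ) (hs : s ^ 2 = -7) {α₀ α₁ : ℤ_[7]} (h : α₀ ≠ 0 ∨ α₁ ≠ 0) :
    ι (α₀ : ℚ_[7]) + ι (α₁ : ℚ_[7]) * s ≠ 0 := by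
  intro h0
  obtain ⟨h1, h2⟩ := (padicReading_eq_zero_iff ι s hs _ _).mp h0
  rw [PadicInt.coe_eq_zero] at h1 h2
  rcases h with h | h
  · exact h h1
  · exact h h2

end Padic

/-! ## §B  Block (A) kernels with `Λ`-VALUED ★-coefficients `A₀, A₁` (the tree's `r_eq_zero_of_s_eq_zero`, `module_identity`,
`key_complex_identity`, `ev_normForm_eq_zero` have `α₀ α₁ : ℤ`; here `A₀ A₁ : Λ` read in `ℂ` by `a₀ a₁` through two value laws) -/

section Abstract

variable {Λ : Type*} [CommRing Λ] {H : Type*} [AddCommGroup H] [Module Λ H]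

/-- `s = 0` is impossible in the dependence: the two scalar identities with `s = 0` force `r₀ = r₁ = 0`
(`(A₀² + 7A₁²)·r_i = 0` in the domain `Λ`). [cite: Kato2004Asterisque, Thm. 12.4 (2) (p. 221)] -/
theorem r_eq_zero_of_s_eq_zero_C [IsDomain Λ] {r₀ r₁ P A₀ A₁ : Λ} {c₁ N2 b₀ b₁ : ℤ}
    (h2 : (2 : Λ) ≠ 0) (hN : A₀ ^ 2 + 7 * A₁ ^ 2 ≠ 0)
    (G0 : (c₁ : Λ) * 0 * ((N2 : Λ) - (b₀ : Λ) * P) = 2 * (A₀ * r₀ - 7 * A₁ * r₁))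
    (G1 : -((c₁ : Λ) * (b₁ : Λ) * 0 * P) = 2 * (A₁ * r₀ + A₀ * r₁)) :
    r₀ = 0 ∧ r₁ = 0 := by
  have e0 : A₀ * r₀ = 7 * A₁ * r₁ := by
    have : 2 * (A₀ * r₀ - 7 * A₁ * r₁) = 0 := by linear_combination -G0
    rcases mul_eq_zero.mp this with h | h
    · exact absurd h h2
    · exact sub_eq_zero.mp h
  have e1 : A₁ * r₀ = -(A₀ * r₁) := by
    have : 2 * (A₁ * r₀ + A₀ * r₁) = 0 := by linear_combination -G1
    rcases mul_eq_zero.mp this with h | h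
    · exact absurd h h2
    · exact eq_neg_of_add_eq_zero_left h
  have k0 : (A₀ ^ 2 + 7 * A₁ ^ 2) * r₀ = 0 := by
    linear_combination A₀ * e0 + (7 * A₁) * e1
  have k1 : (A₀ ^ 2 + 7 * A₁ ^ 2) * r₁ = 0 := by
    linear_combination (-A₁) * e0 + A₀ * e1
  exact ⟨(mul_eq_zero.mp k0).resolve_left hN, (mul_eq_zero.mp k1).resolve_left hN⟩

/-- **The MODULE identity** with `Λ`-valued coefficients: from `s • E = r₀ • Z + r₁ • piK Z` (`s ≠ 0`), `piK² = −7`,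
torsion-freeness and the scalar identities `G0`, `G1`: `2(A₀² + 7A₁²) • E = A₀ • Y − A₁ • piK Y` with
`Y = c₁ • ((N2 − b₀P) • Z) − (c₁b₁) • (P • piK Z)`. [cite: Kato2004Asterisque, (15.16.1) (p. 265) with Thm. 12.4 (2) (p. 221)] -/
theorem module_identity_C (piK : H →+ H) (hpiK_smul : ∀ (f : Λ) (y : H), piK (f • y) = f • piK y)
    (hpiK_sq : ∀ y, piK (piK y) = ((-7 : ℤ) : Λ) • y)
    (htf : ∀ (f : Λ) (x : H), f ≠ 0 → f • x = 0 → x = 0)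
    {s r₀ r₁ P A₀ A₁ : Λ} {E Z : H} (hs : s ≠ 0) (hdep : s • E = r₀ • Z + r₁ • piK Z)
    {c₁ N2 b₀ b₁ : ℤ}
    (G0 : (c₁ : Λ) * s * ((N2 : Λ) - (b₀ : Λ) * P) = 2 * (A₀ * r₀ - 7 * A₁ * r₁))
    (G1 : -((c₁ : Λ) * (b₁ : Λ) * s * P) = 2 * (A₁ * r₀ + A₀ * r₁)) :
    (2 * (A₀ ^ 2 + 7 * A₁ ^ 2)) • E =
      A₀ • ((c₁ : Λ) • (((N2 : Λ) - (b₀ : Λ) * P) • Z) - ((c₁ : Λ) * (b₁ : Λ)) • (P • piK Z))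
        - A₁ • piK ((c₁ : Λ) • (((N2 : Λ) - (b₀ : Λ) * P) • Z) - ((c₁ : Λ) * (b₁ : Λ)) • (P • piK Z)) := by
  have piK_add : ∀ x y : H, piK (x + y) = piK x + piK y := fun x y => map_add piK x y
  have h1 : s • ((c₁ : Λ) • (((N2 : Λ) - (b₀ : Λ) * P) • Z) - ((c₁ : Λ) * (b₁ : Λ)) • (P • piK Z)) =
      (2 : Λ) • (A₀ • (s • E) + A₁ • piK (s • E)) := by
    rw [hdep, piK_add, hpiK_smul, hpiK_smul, hpiK_sq]
    push_cast
    linear_combination (norm := module) G0 • Z + G1 • piK Z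
  have h2 : s • (((c₁ : Λ) • (((N2 : Λ) - (b₀ : Λ) * P) • Z) - ((c₁ : Λ) * (b₁ : Λ)) • (P • piK Z)) -
      (2 : Λ) • (A₀ • E + A₁ • piK E)) = 0 := by
    rw [smul_sub, h1, hpiK_smul]
    module
  have h3 := sub_eq_zero.mp (htf s _ hs h2)
  rw [h3]
  simp only [smul_add, piK_add, hpiK_smul, hpiK_sq]
  push_cast
  module

/-- The complex identity behind the key step, with complex readings `a₀, a₁` of the ★-coefficients.
[cite: Kato2004Asterisque, (15.12.2) (p. 263) and (15.16.1) (p. 265)] -/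
theorem key_complex_identity_C {S R0 R1 q w V VE M Ψ a₀ a₁ : ℂ} {N : ℕ} {c₁ b₀ b₁ : ℤ}
    (hq : q ^ 2 = -7) (hdv : S * VE = R0 * V + q * (R1 * V))
    (hE : VE = ((N : ℂ) - Ψ * w) * M) (hZ : (c₁ : ℂ) * V = (a₀ + a₁ * q) * M)
    (hΨ : 2 * Ψ = (b₀ : ℂ) + (b₁ : ℂ) * q) :
    (((c₁ : ℂ) * S * ((2 * N : ℕ) - (b₀ : ℂ) * w) - 2 * (a₀ * R0 - 7 * a₁ * R1)) * V +
      q * ((-((c₁ * b₁ : ℂ) * S * w) - 2 * (a₁ * R0 + a₀ * R1)) * V)) * M = 0 := by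
  push_cast
  linear_combination ((c₁ : ℂ) * S * w * V * M) * hΨ + (-(2 * (c₁ : ℂ) * S * V)) * hE + (2 * (c₁ : ℂ) * V) * hdv
    + (2 * V * (R0 + q * R1)) * hZ + (2 * a₁ * R1 * V * M) * hq

/-- **The VALUE identity** with `Λ`-valued coefficients: with a `Λ`-semilinear value map `val` (through `ev`), `piK` acting by
`q = √−7`, `A₀, A₁` acting by `a₀, a₁`, the value laws for `E` and `Z` and `val Z ≠ 0`: `ev(g₀² + 7g₁²) = 0` for
`g₀ = c₁·s·(2N − b₀P) − 2(A₀r₀ − 7A₁r₁)`, `g₁ = −(c₁b₁·s·P) − 2(A₁r₀ + A₀r₁)`.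
[cite: Kato2004Asterisque, (15.16.1) (p. 265), (15.12.2) (p. 263), Thm. 12.5 (1) (p. 221)] -/
theorem ev_normForm_eq_zero_C (piK : H →+ H) (val : H →+ ℂ) (ev : Λ → ℂ)
    (hval : ∀ (f : Λ) (m : H), val (f • m) = ev f * val m)
    (hpiK_smul : ∀ (f : Λ) (y : H), piK (f • y) = f • piK y)
    {q : ℂ} (hq : q ^ 2 = -7) (hvpi : ∀ y, val (piK y) = q * val y)
    (hint : ∀ (c : ℤ) (m : H), val ((c : Λ) • m) = c * val m)
    {A₀ A₁ : Λ} {a₀ a₁ : ℂ} (hA₀ : ∀ m, val (A₀ • m) = a₀ * val m) (hA₁ : ∀ m, val (A₁ • m) = a₁ * val m)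
    {P : Λ} {w : ℂ} (hP : ∀ m, val (P • m) = w * val m)
    {s r₀ r₁ : Λ} {E Z : H} (hdep : s • E = r₀ • Z + r₁ • piK Z)
    {N : ℕ} {Ψ M : ℂ} {c₁ b₀ b₁ : ℤ}
    (hE : val E = ((N : ℂ) - Ψ * w) * M) (hZ : (c₁ : ℂ) * val Z = (a₀ + a₁ * q) * M)
    (hΨ : 2 * Ψ = (b₀ : ℂ) + (b₁ : ℂ) * q) (hM : M ≠ 0) (hV : val Z ≠ 0)
    {g₀ g₁ : Λ}
    (hg₀ : g₀ = (c₁ : Λ) * s * (((2 * N : ℕ) : ℤ) - (b₀ : Λ) * P) - 2 * (A₀ * r₀ - 7 * A₁ * r₁))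
    (hg₁ : g₁ = -((c₁ : Λ) * (b₁ : Λ) * s * P) - 2 * (A₁ * r₀ + A₀ * r₁)) :
    ev (g₀ * g₀ + ((7 : ℤ) : Λ) * (g₁ * g₁)) = 0 := by
  have hdv : ev s * val E = ev r₀ * val Z + q * (ev r₁ * val Z) := by
    have := congrArg val hdep
    rwa [hval, map_add, hval, ← hpiK_smul, hvpi, hval] at this
  have hval' : ∀ (f g : Λ) (m : H), val ((f * g) • m) = ev f * val (g • m) := fun f g m => by
    rw [mul_smul, hval]
  have h2v : ∀ m : H, val ((2 : Λ) • m) = 2 * val m := fun m => by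
    have := hint 2 m; push_cast at this; exact this
  have h7v : ∀ m : H, val ((7 : Λ) • m) = 7 * val m := fun m => by
    have := hint 7 m; push_cast at this; exact this
  have hsv : ∀ m : H, val (s • m) = ev s * val m := fun m => hval s m
  have hr₀v : ∀ m : H, val (r₀ • m) = ev r₀ * val m := fun m => hval r₀ m
  have hr₁v : ∀ m : H, val (r₁ • m) = ev r₁ * val m := fun m => hval r₁ m
  have hg₀v : val (g₀ • Z) = ((c₁ : ℂ) * ev s * ((2 * N : ℕ) - (b₀ : ℂ) * w) -
      2 * (a₀ * ev r₀ - 7 * a₁ * ev r₁)) * val Z := by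
    rw [hg₀]
    simp only [sub_smul, mul_smul, map_sub, hint, hsv, hP, h2v, h7v, hA₀, hA₁, hr₀v, hr₁v]
    push_cast
    ring
  have hg₁v : val (g₁ • Z) = (-((c₁ * b₁ : ℂ) * ev s * w) - 2 * (a₁ * ev r₀ + a₀ * ev r₁)) * val Z := by
    rw [hg₁]
    simp only [sub_smul, add_smul, neg_smul, mul_smul, map_sub, map_add, map_neg, hint, hsv, hP, h2v, hA₀, hA₁,
      hr₀v, hr₁v]
    ring
  have key : val (g₀ • Z) + q * val (g₁ • Z) = 0 := by
    have h := key_complex_identity_C (S := ev s) (R0 := ev r₀) (R1 := ev r₁) hq hdv hE hZ hΨ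
    rw [hg₀v, hg₁v]
    rcases mul_eq_zero.mp h with h | h
    · exact h
    · exact absurd h hM
  have hev : ev g₀ * val Z = -(q * (ev g₁ * val Z)) := by
    rw [← hval, ← hval]; exact eq_neg_of_add_eq_zero_left key
  have hev' : ev g₀ = -(q * ev g₁) := by
    apply mul_right_cancel₀ hV; rw [hev]; ring
  have e7 : val ((g₀ * g₀ + ((7 : ℤ) : Λ) * (g₁ * g₁)) • Z) = (ev g₀ * ev g₀ + 7 * (ev g₁ * ev g₁)) * val Z := by
    rw [add_smul, map_add, hval', hval, mul_smul, hint, hval', hval]; push_cast; ring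
  have e8 : val ((g₀ * g₀ + ((7 : ℤ) : Λ) * (g₁ * g₁)) • Z) = 0 := by
    rw [e7, hev']
    have : (-(q * ev g₁) * -(q * ev g₁) + 7 * (ev g₁ * ev g₁)) = (q ^ 2 + 7) * (ev g₁ * ev g₁) := by ring
    rw [this, hq]; ring
  rw [hval] at e8
  rcases mul_eq_zero.mp e8 with h | h
  · exact h
  · exact absurd h hV

end Abstract

/-! ## §C  The datum `KatoExpPadicDatum hγ Φ` (= `KatoExpDatum hγ Φ` with `α₀ α₁ : ℤ_[7]` and the (eZ′) reading through `ι₇`),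
the `Prop` `KatoExpPadicCompatShape`, and the §2 API re-issued -/

section Frame

variable {W : WeierstrassCurve ℚ} [W.IsElliptic] [W.IsGloballyMinimal] [Fact (Nat.Prime 7)]
  [ContinuousSMul ℤ_[7] (W.tateModule 7)] {K : ZpExtension ℚ 7} {hK : K.IsCyclotomic}
  {γ : Field.absoluteGaloisGroup ℚ} {I : IwasawaH1Data W 7 K γ}
  {F : GenusFrame} {θu : ∀ n : ℕ, globalUnitsOf (F.layer n)} {d : GenusDatum F θu}

/-- **`KatoExpPadicDatum hγ Φ` — the `χ`-components of the dual exponential on `𝐇′(S′_W) = Φ.IK.H`, read in ℂ, with Kato's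
value laws for the (λ1) classes `euK 𝔟` and for the ★-class, the ★-CONSTANT `α = α₀ + α₁√−7` A 7-ADIC PAIR `(α₀, α₁) ∈ ℤ₇²`**
(successor of `KatoExpDatum hγ Φ`, pen D1085 (ρ1)/(III) = row K2C-9R; hazard (H-γ) of `StarValuePin_g79.md` REV 1.1 §8):
every field is LETTER-IDENTICAL to `KatoExpDatum` (`RamifiedSevenGenusKatoExpDatum.lean` :130–199) except `α₀ α₁ : ℤ_[7]`
(there `: ℤ`), and (eZ′) `val_zStar`, whose right side reads the pair through the datum's own `ι₇ : ℚ₇ → ℂ`: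
`(ι₇ α₀ + ι₇ α₁·ιC(√−7))·Ω⁻¹·Lf 1` (there `((α₀ : ℂ) + (α₁ : ℂ)·ιC(√−7))·Ω⁻¹·Lf 1`).  `α_ne_zero` keeps its letter at the
new type.  A HYPOTHESIS STRUCTURE; nothing is asserted to exist; no named fact.
[cite: Kato2004Asterisque, Prop. 15.9 (15.9.1) (pp. 258–259), Thm. 12.5 (1) (p. 221), (15.12.2) (p. 263), 15.14 (p. 264), (15.16.1) (p. 265), §15.7 (p. 256)]
[cite: BlochKato1990, Def. 3.10 and Ex. 3.10.1–3.11 (pp. 359–361)] [cite: NeukirchSchmidtWingberg2008, XI §1–§2] -/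
structure KatoExpPadicDatum (hγ : K.IsTopGenerator γ) (Φ : PinnedKatoGenusFrame W K hK I d) : Type where
  /-- A complex reading of `7`-adic coefficients. -/
  ι₇ : ℚ_[7] →+* ℂ
  /-- The `χ`-component of `exp*` on `𝐇′(S′_W)`, read in ℂ, for every continuous character `χ` of `Γ_{Kcm}`. -/
  val : (absoluteGaloisGroup Φ.Kcm →ₜ* ℂˣ) → (Φ.IK.H →+ ℂ)
  /-- (e1) naturality of `exp*`: `γK` acts on the `χ`-component by `χ(γK)⁻¹`, for `χ` of finite level. -/
  val_T : ∀ (χ : absoluteGaloisGroup Φ.Kcm →ₜ* ℂˣ),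
    (∃ n : ℕ, ∀ σ ∈ (K.restrictOfFinrankEqTwo (by decide) Φ.Kcm Φ.finrank_Kcm).layerSubgroup n, χ σ = 1) →
    ∀ (x : Φ.IK.H),
      val χ ((1 + PowerSeries.X : IwasawaAlgebra 7) • x) = (((χ Φ.γK)⁻¹ : ℂˣ) : ℂ) * val χ x
  /-- (e1′) `ℤ₇`-linearity, read through `ι₇`, for `χ` of finite level. -/
  val_C : ∀ (χ : absoluteGaloisGroup Φ.Kcm →ₜ* ℂˣ),
    (∃ n : ℕ, ∀ σ ∈ (K.restrictOfFinrankEqTwo (by decide) Φ.Kcm Φ.finrank_Kcm).layerSubgroup n, χ σ = 1) →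
    ∀ (c : ℤ_[7]) (x : Φ.IK.H),
      val χ ((PowerSeries.C c : IwasawaAlgebra 7) • x) = ι₇ (c : ℚ_[7]) * val χ x
  /-- (e2) CM-functoriality: the CM operator `piK` (`= (T₇φ)_*`) acts on values by `ιC(√−7)`, for `χ` of finite level. -/
  val_piK : ∀ (χ : absoluteGaloisGroup Φ.Kcm →ₜ* ℂˣ),
    (∃ n : ℕ, ∀ σ ∈ (K.restrictOfFinrankEqTwo (by decide) Φ.Kcm Φ.finrank_Kcm).layerSubgroup n, χ σ = 1) →
    ∀ (x : Φ.IK.H),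
      val χ (Φ.piK x) = Φ.ιC (algebraMap Φ.Kcm (AlgebraicClosure Φ.Kcm) Φ.sqrtNegSeven) * val χ x
  /-- (eV) the values of the elliptic-unit classes: (15.9.1) on the cyclotomic layer `Kℚ_n` (= the frame's (Z4)(Z5)). -/
  val_euK : ∀ (𝔟 : Ideal (𝓞 Φ.Kcm)), IsTwist 7 Φ.𝔣 𝔟 → ∀ (n : ℕ) (χ : absoluteGaloisGroup Φ.Kcm →ₜ* ℂˣ),
    (∀ σ ∈ (K.restrictOfFinrankEqTwo (by decide) Φ.Kcm Φ.finrank_Kcm).layerSubgroup n, χ σ = 1) →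
    ∀ Lf : ℂ → ℂ, CM.IsDepletedHeckeL Φ.ψ χ (7 * (7 * F.d)) Lf →
      val χ (Φ.euK 𝔟) =
        (((Ideal.absNorm 𝔟 : ℕ) : ℂ) - CM.heckeCharIdealValue Φ.ψ 𝔟 * (heckeIdealValue χ 𝔟)⁻¹) * Φ.Ω⁻¹ * Lf 1
  /-- (eZ) the ★-unit and the `Λˣ`-normalised ★-class `zStar` (`uStar • zStar = res zOne`) … -/
  uStar : (IwasawaAlgebra 7)ˣ
  zStar : Φ.IK.H
  uStar_smul_zStar : ((uStar : IwasawaAlgebra 7)) • zStar = I.resOver Φ.IK hγ Φ.isTopGenerator_γK Φ.zOne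
  /-- … its value constants: a `7`-power `7^e`, a 7-ADIC PAIR `α = α₀ + α₁√−7 ∈ (K ⊗ ℚ₇)^×` read INTEGRALLY in `ℤ₇²`
  (pen D1085 (ρ1): Kato's constant of (15.16.1) lives in `(O_K ⊗ ℤ₇) ∖ {0}`, not in `O_K`), a threshold `n₀` … -/
  e : ℕ
  α₀ : ℤ_[7]
  α₁ : ℤ_[7]
  α_ne_zero : α₀ ≠ 0 ∨ α₁ ≠ 0
  n₀ : ℕ
  /-- (eZ′) … and its value law at characters of PRIMITIVE level `n + 1`, `n ≥ n₀`, the pair READ THROUGH `ι₇`. -/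
  val_zStar : ∀ (n : ℕ), n₀ ≤ n → ∀ (χ : absoluteGaloisGroup Φ.Kcm →ₜ* ℂˣ),
    (∀ σ ∈ (K.restrictOfFinrankEqTwo (by decide) Φ.Kcm Φ.finrank_Kcm).layerSubgroup (n + 1), χ σ = 1) →
    IsPrimitiveRoot (((χ Φ.γK : ℂˣ)) : ℂ) (7 ^ (n + 1)) →
    ∀ Lf : ℂ → ℂ, CM.IsDepletedHeckeL Φ.ψ χ (7 * (7 * F.d)) Lf →
      (7 : ℂ) ^ e * val χ zStar =
        (ι₇ (α₀ : ℚ_[7]) + ι₇ (α₁ : ℚ_[7]) * Φ.ιC (algebraMap Φ.Kcm (AlgebraicClosure Φ.Kcm) Φ.sqrtNegSeven)) *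
          Φ.Ω⁻¹ * Lf 1
  /-- (psiK) `ψ(𝔟) ∈ O_K = ℤ[(1+√−7)/2]`: the integer coordinates `2ψ(𝔟) = b₀(𝔟) + b₁(𝔟)√−7` (Skolemised). -/
  bCoef₀ : Ideal (𝓞 Φ.Kcm) → ℤ
  bCoef₁ : Ideal (𝓞 Φ.Kcm) → ℤ
  psi_eq : ∀ (𝔟 : Ideal (𝓞 Φ.Kcm)), IsTwist 7 Φ.𝔣 𝔟 →
    2 * CM.heckeCharIdealValue Φ.ψ 𝔟 =
      (bCoef₀ 𝔟 : ℂ) + (bCoef₁ 𝔟 : ℂ) * Φ.ιC (algebraMap Φ.Kcm (AlgebraicClosure Φ.Kcm) Φ.sqrtNegSeven)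
  /-- (art) RE-TYPED: the `7`-ADIC Artin exponent `κ(𝔟) ∈ ℤ₇` of an admissible twist, `(𝔟, Kℚ_∞/K) = γK^{κ(𝔟)}`
  (Skolemised) … -/
  artExp : Ideal (𝓞 Φ.Kcm) → ℤ_[7]
  /-- … and Artin reciprocity LEVEL-WISE: `χ(𝔟) = χ(γK)^m` for every `χ` trivial on `U_n` and every natural
  `m ≡ κ(𝔟) (mod 7^n)`. -/
  art : ∀ (𝔟 : Ideal (𝓞 Φ.Kcm)), IsTwist 7 Φ.𝔣 𝔟 → ∀ (n m : ℕ),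
    PadicInt.toZModPow n (artExp 𝔟) = (m : ZMod (7 ^ n)) →
    ∀ (χ : absoluteGaloisGroup Φ.Kcm →ₜ* ℂˣ),
      (∀ σ ∈ (K.restrictOfFinrankEqTwo (by decide) Φ.Kcm Φ.finrank_Kcm).layerSubgroup n, χ σ = 1) →
        heckeIdealValue χ 𝔟 = (((χ Φ.γK : ℂˣ)) : ℂ) ^ m

/-- **`KatoExpPadicCompatShape hγ Φ`** :≡ the pinned frame `Φ` ADMITS a dual-exponential value datum with 7-adic ★-constants —
the (r3) binder of block (R) over `KatoExpPadicDatum` (successor of `KatoExpCompatShape`).  A predicate (`Nonempty`); nothing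
asserted. [cite: Kato2004Asterisque, Prop. 15.9 (p. 258), Thm. 12.5 (1) (p. 221), (15.16.1) (p. 265)] [cite: BlochKato1990, Def. 3.10 (p. 359)] -/
def KatoExpPadicCompatShape (hγ : K.IsTopGenerator γ) (Φ : PinnedKatoGenusFrame W K hK I d) : Prop :=
  Nonempty (KatoExpPadicDatum hγ Φ)

/-- Unfolding `KatoExpPadicCompatShape`. [cite: Kato2004Asterisque, (15.16.1) (p. 265)] -/
theorem katoExpPadicCompatShape_iff (hγ : K.IsTopGenerator γ) (Φ : PinnedKatoGenusFrame W K hK I d) :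
    KatoExpPadicCompatShape hγ Φ ↔ Nonempty (KatoExpPadicDatum hγ Φ) :=
  Iff.rfl

/-- A value `V` subject to a ★-type value law `7^e·V = (ι α₀ + ι α₁·ιC(√−7))·Ω⁻¹·L` with a 7-ADIC pair `(α₀, α₁) ≠ 0` and
`L ≠ 0` is NON-ZERO — datum-free form of «the values of the ★-class are non-zero where `L_{7f}(ψ̄, χ, 1) ≠ 0`» in the 7-adic
currency (the reading `ℚ₇ ⊕ ℚ₇√−7 → ℂ` is injective because `−7` is not a square in `ℚ₇`); fed with (eZ′) by block (R).
[cite: Kato2004Asterisque, Thm. 12.5 (2) (p. 221) and 13.5 (p. 227)] -/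
theorem ne_zero_of_padicValueLaw (Φ : PinnedKatoGenusFrame W K hK I d) (ι : ℚ_[7] →+* ℂ) {α₀ α₁ : ℤ_[7]}
    (hα : α₀ ≠ 0 ∨ α₁ ≠ 0) {e : ℕ} {V L : ℂ}
    (h : (7 : ℂ) ^ e * V = (ι (α₀ : ℚ_[7]) + ι (α₁ : ℚ_[7]) * Φ.ιC (algebraMap Φ.Kcm (AlgebraicClosure Φ.Kcm) Φ.sqrtNegSeven)) *
      Φ.Ω⁻¹ * L) (hL : L ≠ 0) : V ≠ 0 := by
  intro h0
  rw [h0, mul_zero] at h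
  exact mul_ne_zero (mul_ne_zero (padicReading_ne_zero ι _ Φ.ιC_sqrtNegSeven_sq hα) (inv_ne_zero Φ.Ω_ne_zero)) hL h.symm

namespace KatoExpPadicDatum

variable {hγ : K.IsTopGenerator γ} {Φ : PinnedKatoGenusFrame W K hK I d} (D : KatoExpPadicDatum hγ Φ)

/-- `val χ (f • piK y) = ιC(√−7)·val χ (f • y)` (χ of finite level). [cite: Kato2004Asterisque, §15.3 (p. 252) and 15.14 (p. 264)] -/
theorem val_smul_piK (χ : absoluteGaloisGroup Φ.Kcm →ₜ* ℂˣ)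
    (hχ : ∃ n : ℕ, ∀ σ ∈ (K.restrictOfFinrankEqTwo (by decide) Φ.Kcm Φ.finrank_Kcm).layerSubgroup n, χ σ = 1)
    (f : IwasawaAlgebra 7) (y : Φ.IK.H) :
    D.val χ (f • Φ.piK y) = Φ.ιC (algebraMap Φ.Kcm (AlgebraicClosure Φ.Kcm) Φ.sqrtNegSeven) * D.val χ (f • y) := by
  rw [← Φ.piK_smul, D.val_piK χ hχ]

/-- Integer scalars pass through `val`: `val χ ((c : Λ) • x) = c·val χ x` (`ι₇` is the identity on ℤ; χ of finite level).
[cite: Kato2004Asterisque, Thm. 12.5 (1) (p. 221)] -/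
theorem val_intCast_smul (χ : absoluteGaloisGroup Φ.Kcm →ₜ* ℂˣ)
    (hχ : ∃ n : ℕ, ∀ σ ∈ (K.restrictOfFinrankEqTwo (by decide) Φ.Kcm Φ.finrank_Kcm).layerSubgroup n, χ σ = 1)
    (c : ℤ) (x : Φ.IK.H) :
    D.val χ ((c : IwasawaAlgebra 7) • x) = (c : ℂ) * D.val χ x := by
  have h : ((c : IwasawaAlgebra 7)) = PowerSeries.C ((c : ℤ_[7])) := by
    rw [map_intCast]
  rw [h, D.val_C χ hχ, PadicInt.coe_intCast, map_intCast]

/-- `ℤ₇`-scalars through the `ℤ₇`-ALGEBRA structure of `Λ` pass through `val` by `ι₇`: `val χ ((algebraMap ℤ₇ Λ c) • x) =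
ι₇ c · val χ x` (`algebraMap ℤ₇ Λ = PowerSeries.C`; χ of finite level). [cite: Kato2004Asterisque, Thm. 12.5 (1) (p. 221)] -/
theorem val_algebraMap_smul (χ : absoluteGaloisGroup Φ.Kcm →ₜ* ℂˣ)
    (hχ : ∃ n : ℕ, ∀ σ ∈ (K.restrictOfFinrankEqTwo (by decide) Φ.Kcm Φ.finrank_Kcm).layerSubgroup n, χ σ = 1)
    (c : ℤ_[7]) (x : Φ.IK.H) :
    D.val χ ((algebraMap ℤ_[7] (IwasawaAlgebra 7) c) • x) = D.ι₇ (c : ℚ_[7]) * D.val χ x := by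
  rw [← PowerSeries.C_eq_algebraMap, D.val_C χ hχ]

/-- **`D.sigma 𝔟 = σ_𝔟 := (1+X)^{κ(𝔟)} ∈ Λ`** — the image in `Λ = ℤ₇⟦X⟧` (`γK ↦ 1 + X`) of the Artin symbol
`(𝔟, Kℚ_∞/K) = γK^{κ(𝔟)}`: the binomial power series with the `7`-adic exponent `κ(𝔟) = D.artExp 𝔟`.
[cite: Washington1997, §13.2] [cite: Kato2004Asterisque, (15.12.2) (p. 263)] -/
def sigma (𝔟 : Ideal (𝓞 Φ.Kcm)) : IwasawaAlgebra 7 :=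
  PowerSeries.binomialSeries ℤ_[7] (D.artExp 𝔟)

/-- Unfolding `sigma`. [cite: Washington1997, §13.2] -/
theorem sigma_def (𝔟 : Ideal (𝓞 Φ.Kcm)) : D.sigma 𝔟 = PowerSeries.binomialSeries ℤ_[7] (D.artExp 𝔟) := rfl

/-- Every level `n` has a natural lift `m ≡ κ(𝔟) (mod 7^n)`. [cite: NeukirchSchmidtWingberg2008, XI §1] -/
theorem exists_nat_toZModPow_artExp (𝔟 : Ideal (𝓞 Φ.Kcm)) (n : ℕ) :
    ∃ m : ℕ, PadicInt.toZModPow n (D.artExp 𝔟) = (m : ZMod (7 ^ n)) := by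
  haveI : NeZero (7 ^ n) := ⟨pow_ne_zero n (by norm_num)⟩
  exact ⟨(PadicInt.toZModPow n (D.artExp 𝔟)).val, (ZMod.natCast_zmod_val _).symm⟩

/-- (art) inverted: `χ(𝔟)⁻¹ = (χ(γK)⁻¹)^m` for `χ` of level `n` and a natural lift `m ≡ κ(𝔟) (mod 7^n)`.
[cite: NeukirchSchmidtWingberg2008, XI §2 (Artin map of a ℤ_p-extension)] -/
theorem inv_heckeIdealValue_eq_pow (χ : absoluteGaloisGroup Φ.Kcm →ₜ* ℂˣ) {n : ℕ}
    (hχ : ∀ σ ∈ (K.restrictOfFinrankEqTwo (by decide) Φ.Kcm Φ.finrank_Kcm).layerSubgroup n, χ σ = 1)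
    {𝔟 : Ideal (𝓞 Φ.Kcm)} (h𝔟 : IsTwist 7 Φ.𝔣 𝔟) {m : ℕ}
    (hm : PadicInt.toZModPow n (D.artExp 𝔟) = (m : ZMod (7 ^ n))) :
    (heckeIdealValue χ 𝔟)⁻¹ = ((((χ Φ.γK)⁻¹ : ℂˣ)) : ℂ) ^ m := by
  rw [D.art 𝔟 h𝔟 n m hm χ hχ, Units.val_inv_eq_inv_val, inv_pow]

/-- `σ_𝔟` acts on the values at a level-`n` character by `(χ(γK)⁻¹)^m`, `m` any natural lift of `κ(𝔟) mod 7^n`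
((e1) + `(χ γK)⁻¹ ^ 7^n = 1` + `(1+X)^{κ} ≡ (1+X)^m (mod ω_n)`). [cite: Washington1997, §13.2]
[cite: Kato2004Asterisque, Thm. 12.5 (1) (p. 221)] -/
theorem val_sigma_smul_eq_pow (χ : absoluteGaloisGroup Φ.Kcm →ₜ* ℂˣ) {n : ℕ}
    (hχ : ∀ σ ∈ (K.restrictOfFinrankEqTwo (by decide) Φ.Kcm Φ.finrank_Kcm).layerSubgroup n, χ σ = 1)
    (𝔟 : Ideal (𝓞 Φ.Kcm)) {m : ℕ} (hm : PadicInt.toZModPow n (D.artExp 𝔟) = (m : ZMod (7 ^ n))) (y : Φ.IK.H) :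
    D.val χ (D.sigma 𝔟 • y) = ((((χ Φ.γK)⁻¹ : ℂˣ)) : ℂ) ^ m * D.val χ y :=
  val_binomialSeries_smul (D.val_T χ ⟨n, hχ⟩) (Φ.inv_chi_γK_pow_eq_one χ hχ) hm y

/-- ★ **THE EIGEN-LEMMA (the (T-c) interface of block (R))**: `val χ (σ_𝔟 • y) = χ(𝔟)⁻¹ · val χ y` for every `χ` of
finite level `n` and every admissible `𝔟` (from (e1), (art) at a natural lift, and the `ω_n`-congruence of `p`-adic powers).
[cite: Kato2004Asterisque, (15.12.2) (p. 263) and Thm. 12.5 (1) (p. 221)] [cite: Washington1997, §13.2] -/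
theorem val_sigma_smul (χ : absoluteGaloisGroup Φ.Kcm →ₜ* ℂˣ) {n : ℕ}
    (hχ : ∀ σ ∈ (K.restrictOfFinrankEqTwo (by decide) Φ.Kcm Φ.finrank_Kcm).layerSubgroup n, χ σ = 1)
    {𝔟 : Ideal (𝓞 Φ.Kcm)} (h𝔟 : IsTwist 7 Φ.𝔣 𝔟) (y : Φ.IK.H) :
    D.val χ (D.sigma 𝔟 • y) = (heckeIdealValue χ 𝔟)⁻¹ * D.val χ y := by
  obtain ⟨m, hm⟩ := D.exists_nat_toZModPow_artExp 𝔟 n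
  rw [D.val_sigma_smul_eq_pow χ hχ 𝔟 hm, D.inv_heckeIdealValue_eq_pow χ hχ h𝔟 hm]

/-- `charEval` of `σ_𝔟` at level `n`: `charEval 7 ι u n (σ_𝔟) = u^m` for `u^{7^n} = 1` and a natural lift `m` of
`κ(𝔟) mod 7^n`. [cite: Washington1997, §13.2 and §7.1 Prop. 7.2] -/
theorem charEval_sigma {B : Type*} [CommRing B] (ι : ℤ_[7] →+* B) {u : B} {n : ℕ} (hu : u ^ 7 ^ n = 1)
    (𝔟 : Ideal (𝓞 Φ.Kcm)) {m : ℕ} (hm : PadicInt.toZModPow n (D.artExp 𝔟) = (m : ZMod (7 ^ n))) :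
    charEval 7 ι u n (D.sigma 𝔟) = u ^ m :=
  charEval_binomialSeries 7 ι hu hm

/-- The (eZ′) values of the ★-class are NON-ZERO at primitive level `n + 1 ≥ n₀ + 1` where `Lf 1 ≠ 0`.
[cite: Kato2004Asterisque, Thm. 12.5 (2) (p. 221) and 13.5 (p. 227)] -/
theorem val_zStar_ne_zero {n : ℕ} (hn : D.n₀ ≤ n) (χ : absoluteGaloisGroup Φ.Kcm →ₜ* ℂˣ)
    (hχ : ∀ σ ∈ (K.restrictOfFinrankEqTwo (by decide) Φ.Kcm Φ.finrank_Kcm).layerSubgroup (n + 1), χ σ = 1)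
    (hprim : IsPrimitiveRoot (((χ Φ.γK : ℂˣ)) : ℂ) (7 ^ (n + 1))) {Lf : ℂ → ℂ}
    (hLf : CM.IsDepletedHeckeL Φ.ψ χ (7 * (7 * F.d)) Lf) (hL1 : Lf 1 ≠ 0) : D.val χ D.zStar ≠ 0 :=
  ne_zero_of_padicValueLaw Φ D.ι₇ D.α_ne_zero (D.val_zStar n hn χ hχ hprim Lf hLf) hL1

/-! ## §D  The EXPLICIT data of block (R) over `KatoExpPadicDatum` (7-adic currency: `C α`, `N(α) ∈ ℤ₇`, `jα = v₇(N(α))`) -/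

/-- **`D.xTilde 𝔟 ∈ Λ_O`** — `2N𝔟 − (b₀(𝔟) + b₁(𝔟)·π)·σ_𝔟` (verbatim). [cite: Kato2004Asterisque, (15.12.2) (p. 263) and 15.14 (p. 264)] -/
def xTilde (𝔟 : Ideal (𝓞 Φ.Kcm)) : Φ.R :=
  algebraMap (IwasawaAlgebra 7) Φ.R
      ((((2 * Ideal.absNorm 𝔟 : ℕ) : ℤ) : IwasawaAlgebra 7) - (D.bCoef₀ 𝔟 : IwasawaAlgebra 7) * D.sigma 𝔟) -
    algebraMap (IwasawaAlgebra 7) Φ.R (D.bCoef₁ 𝔟 : IwasawaAlgebra 7) *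
      algebraMap (IwasawaAlgebra 7) Φ.R (D.sigma 𝔟) * Φ.π

/-- Unfolding `xTilde`. [cite: Kato2004Asterisque, (15.12.2) (p. 263)] -/
theorem xTilde_def (𝔟 : Ideal (𝓞 Φ.Kcm)) :
    D.xTilde 𝔟 =
      algebraMap (IwasawaAlgebra 7) Φ.R
          ((((2 * Ideal.absNorm 𝔟 : ℕ) : ℤ) : IwasawaAlgebra 7) - (D.bCoef₀ 𝔟 : IwasawaAlgebra 7) * D.sigma 𝔟) -
        algebraMap (IwasawaAlgebra 7) Φ.R (D.bCoef₁ 𝔟 : IwasawaAlgebra 7) *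
          algebraMap (IwasawaAlgebra 7) Φ.R (D.sigma 𝔟) * Φ.π :=
  rfl

/-- **`D.cZ ∈ Λ_O`** — the explicit right constant `(C α₀ − C α₁·π)·7^e · uStar⁻¹·7^k·u·π^a` of block (R); the 7-adic pair
enters ONLY through `algebraMap Λ Λ_O ∘ PowerSeries.C` (no `ι₇`; pen D1086 (c4)). [cite: Kato2004Asterisque, (15.16.1) (p. 265) and Thm. 12.5 (1) (p. 221)] -/
def cZ : Φ.R :=
  ((algebraMap (IwasawaAlgebra 7) Φ.R (PowerSeries.C D.α₀) -
        algebraMap (IwasawaAlgebra 7) Φ.R (PowerSeries.C D.α₁) * Φ.π) *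
      algebraMap (IwasawaAlgebra 7) Φ.R ((7 ^ D.e : ℤ) : IwasawaAlgebra 7)) *
    (algebraMap (IwasawaAlgebra 7) Φ.R (↑(D.uStar⁻¹) : IwasawaAlgebra 7) *
      (algebraMap (IwasawaAlgebra 7) Φ.R ((7 : IwasawaAlgebra 7) ^ Φ.k) * ((Φ.u : Φ.R) * Φ.π ^ Φ.a)))

/-- `N(α) = α₀² + 7α₁² ∈ ℤ₇` (7-adic currency of `KatoExpDatum.normA : ℕ`). [cite: Kato2004Asterisque, (15.16.1) (p. 265)] -/
def normA : ℤ_[7] := D.α₀ ^ 2 + 7 * D.α₁ ^ 2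

/-- Unfolding `normA`. [cite: Kato2004Asterisque, (15.16.1) (p. 265)] -/
theorem normA_def : D.normA = D.α₀ ^ 2 + 7 * D.α₁ ^ 2 := rfl

/-- `N(α) ≠ 0` (`x² + 7y²` is anisotropic over `ℤ₇`). [cite: Kato2004Asterisque, (15.16.1) (p. 265)] -/
theorem normA_ne_zero : D.normA ≠ 0 := normSeven_ne_zero D.α_ne_zero

/-- `jα = v₇(N(α)) : ℕ` through Mathlib's `PadicInt.valuation : ℤ_[p] → ℕ` (7-adic currency of `KatoExpDatum.jα =
normA.factorization 7`). [cite: Kato2004Asterisque, (15.16.1) (p. 265)] -/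
def jα : ℕ := D.normA.valuation

/-- Unfolding `jα`. [cite: Kato2004Asterisque, (15.16.1) (p. 265)] -/
theorem jα_def : D.jα = (D.α₀ ^ 2 + 7 * D.α₁ ^ 2).valuation := rfl

/-- The unit part `N(α)/7^{jα} ∈ ℤ₇ˣ` (`PadicInt.unitCoeff`). [cite: Kato2004Asterisque, (15.16.1) (p. 265)] -/
def normUnit : ℤ_[7]ˣ := PadicInt.unitCoeff D.normA_ne_zero

/-- `N(α) = (N(α)/7^{jα})·7^{jα}`. [cite: Kato2004Asterisque, (15.16.1) (p. 265)] -/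
theorem normA_eq_normUnit_mul_pow : D.normA = (D.normUnit : ℤ_[7]) * 7 ^ D.jα :=
  eq_unitCoeff_mul_pow_valuation D.normA_ne_zero

/-- `7^{jα} ∣ N(α)`. [cite: Kato2004Asterisque, (15.16.1) (p. 265)] -/
theorem seven_pow_jα_dvd_normA : (7 : ℤ_[7]) ^ D.jα ∣ D.α₀ ^ 2 + 7 * D.α₁ ^ 2 :=
  pow_valuation_dvd D.normA_ne_zero

/-- **`D.wα ∈ Λ_O`** — the explicit left unit `v^{jα}·(2·N(α)/7^{jα})` of block (R), the unit part through `C`.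
[cite: Kato2004Asterisque, (15.16.1) (p. 265)] -/
def wα : Φ.R :=
  (Φ.v : Φ.R) ^ D.jα * algebraMap (IwasawaAlgebra 7) Φ.R ((2 : IwasawaAlgebra 7) * PowerSeries.C (D.normUnit : ℤ_[7]))

/-- `wα` is a unit of `Λ_O` (`2 ∈ ℤ₇ˣ`, `N(α)/7^{jα} ∈ ℤ₇ˣ`, `v ∈ Λ_Oˣ`). [cite: Washington1997, §7.1] -/
theorem isUnit_wα : IsUnit D.wα := by
  have h2 : IsUnit (2 : IwasawaAlgebra 7) := by
    have h := isUnit_two_padicInt.map (PowerSeries.C (R := ℤ_[7]))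
    rwa [map_ofNat] at h
  have hC : IsUnit (PowerSeries.C (D.normUnit : ℤ_[7]) : IwasawaAlgebra 7) := D.normUnit.isUnit.map _
  exact (Φ.v.isUnit.pow D.jα).mul ((h2.mul hC).map (algebraMap (IwasawaAlgebra 7) Φ.R))

/-- `C (2N(α)) = (2·C(N(α)/7^{jα}))·7^{jα}` in `Λ`. [cite: Kato2004Asterisque, (15.16.1) (p. 265)] -/
theorem C_two_mul_normA :
    (PowerSeries.C (2 * (D.α₀ ^ 2 + 7 * D.α₁ ^ 2)) : IwasawaAlgebra 7) =
      ((2 : IwasawaAlgebra 7) * PowerSeries.C (D.normUnit : ℤ_[7])) * (7 : IwasawaAlgebra 7) ^ D.jα := by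
  rw [← D.normA_def, D.normA_eq_normUnit_mul_pow, map_mul, map_mul, map_pow, map_ofNat, map_ofNat]
  ring

/-- The left constant of ★ is `wα·π^{m₀ + 2jα}` (`2N(α) = (2N(α)/7^{jα})·7^{jα}`, `7 = v·π²`).
[cite: Kato2004Asterisque, (15.16.1) (p. 265)] -/
theorem sTwoSided_eq (m₀ : ℕ) :
    Φ.π ^ m₀ * algebraMap (IwasawaAlgebra 7) Φ.R (PowerSeries.C (2 * (D.α₀ ^ 2 + 7 * D.α₁ ^ 2))) =
      D.wα * Φ.π ^ (m₀ + 2 * D.jα) := by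
  have h7 : algebraMap (IwasawaAlgebra 7) Φ.R 7 = (Φ.v : Φ.R) * Φ.π ^ 2 := by
    rw [map_ofNat]; exact Φ.seven_eq
  rw [D.C_two_mul_normA, map_mul, map_pow, h7, KatoExpPadicDatum.wα, pow_add, pow_mul, mul_pow]
  ring

/-- In `Λ`: `(C α₀)² + 7(C α₁)² = C(N(α)) ≠ 0`. [cite: Kato2004Asterisque, (15.16.1) (p. 265)] -/
theorem C_sq_add_seven_mul_C_sq_ne_zero :
    (PowerSeries.C D.α₀ : IwasawaAlgebra 7) ^ 2 + 7 * (PowerSeries.C D.α₁ : IwasawaAlgebra 7) ^ 2 ≠ 0 := by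
  have h : (PowerSeries.C D.α₀ : IwasawaAlgebra 7) ^ 2 + 7 * (PowerSeries.C D.α₁ : IwasawaAlgebra 7) ^ 2 =
      PowerSeries.C D.normA := by
    rw [KatoExpPadicDatum.normA, map_add, map_mul, map_pow, map_pow, map_ofNat]
  rw [h, Ne, ← map_zero (PowerSeries.C (R := ℤ_[7])), (PowerSeries.C_injective).eq_iff]
  exact D.normA_ne_zero

/-- `2·((C α₀)² + 7(C α₁)²) = C(2N(α))` in `Λ` (the left scalar of the module identity vs. the left constant of ★).
[cite: Kato2004Asterisque, (15.16.1) (p. 265)] -/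
theorem two_mul_C_sq_add_eq :
    (2 * ((PowerSeries.C D.α₀ : IwasawaAlgebra 7) ^ 2 + 7 * (PowerSeries.C D.α₁ : IwasawaAlgebra 7) ^ 2)) =
      PowerSeries.C (2 * (D.α₀ ^ 2 + 7 * D.α₁ ^ 2)) := by
  rw [map_mul, map_add, map_mul, map_pow, map_pow, map_ofNat, map_ofNat]

/-- `D.cZ` with its casts normalised: `(C α₀ − C α₁·π)·7^e·(A(uStar⁻¹)·(7^k·(u·π^a)))`. [cite: Kato2004Asterisque, (15.16.1) (p. 265)] -/
theorem cZ_eq :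
    D.cZ = ((algebraMap (IwasawaAlgebra 7) Φ.R (PowerSeries.C D.α₀) -
          algebraMap (IwasawaAlgebra 7) Φ.R (PowerSeries.C D.α₁) * Φ.π) * (7 : Φ.R) ^ D.e) *
      (algebraMap (IwasawaAlgebra 7) Φ.R (↑(D.uStar⁻¹) : IwasawaAlgebra 7) *
        ((7 : Φ.R) ^ Φ.k * ((Φ.u : Φ.R) * Φ.π ^ Φ.a))) := by
  simp only [KatoExpPadicDatum.cZ, map_pow, map_ofNat, Int.cast_pow, Int.cast_ofNat]

/-- **The D916 divisibility input from the integer inequality, general gauge** (the (PK) predicate `PeriodPositionFieldAt`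
written out, 7-adic currency): for any cofactor `t′ = w′·π^{m′}`, `m₀ + jα ≤ 2e + 2k + a + m′ ⟹ Φ.π ^ (m₀ + 2·jα) ∣ D.cZ * t′`.
[cite: Kato2004Asterisque, (15.16.1) (p. 265)] -/
theorem pow_dvd_cZ_mul_of_leAt (t' w' : Φ.R) (m₀ m' : ℕ) (ht' : t' = w' * Φ.π ^ m')
    (h : m₀ + D.jα ≤ 2 * D.e + 2 * Φ.k + Φ.a + m') : Φ.π ^ (m₀ + 2 * D.jα) ∣ D.cZ * t' := by
  have hle : m₀ + 2 * (D.α₀ ^ 2 + 7 * D.α₁ ^ 2).valuation ≤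
      (D.α₀ ^ 2 + 7 * D.α₁ ^ 2).valuation + (2 * D.e + 2 * Φ.k + Φ.a) + m' := by
    change m₀ + 2 * D.jα ≤ D.jα + (2 * D.e + 2 * Φ.k + Φ.a) + m'
    omega
  have key := pow_dvd_constZ_mul_of_le ((algebraMap (IwasawaAlgebra 7) Φ.R).comp (PowerSeries.C (R := ℤ_[7])))
    Φ.π (Φ.v : Φ.R) Φ.seven_eq D.α₀ D.α₁ D.α_ne_zero D.e Φ.k Φ.a m₀ m'
    (algebraMap (IwasawaAlgebra 7) Φ.R (↑(D.uStar⁻¹) : IwasawaAlgebra 7)) (Φ.u : Φ.R) w' hle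
  rw [D.cZ_eq, ht']
  exact key

/-- **Unit-`t` gauge** (the (PK) predicate `PeriodPositionField` written out): `t′ = w′·π^{m₀}` and `jα ≤ 2e + 2k + a ⟹
Φ.π ^ (m₀ + 2·jα) ∣ D.cZ * t′`. [cite: Kato2004Asterisque, (15.16.1) (p. 265)] -/
theorem pow_dvd_cZ_mul_of_le (t' w' : Φ.R) (m₀ : ℕ) (ht' : t' = w' * Φ.π ^ m₀) (h : D.jα ≤ 2 * D.e + 2 * Φ.k + Φ.a) :
    Φ.π ^ (m₀ + 2 * D.jα) ∣ D.cZ * t' :=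
  D.pow_dvd_cZ_mul_of_leAt t' w' m₀ m₀ ht' (by omega)

end KatoExpPadicDatum

/-! ## §E  Block (R) over `KatoExpPadicDatum`: ★ two-sided / ★′ period-scaled / rational / K2ᶜ-of-divisibility
(the proofs of `RamifiedSevenRationalComparisonOfInputsR.lean` with `(α_i : Λ) ↦ C α_i`, `(α_i : ℂ) ↦ ι₇ α_i`) -/

set_option maxHeartbeats 800000 in
/-- ★ **THE TWO-SIDED COMPARISON WITH EXPLICIT CONSTANTS, FROM ITS INPUTS, 7-ADIC ★-CONSTANTS**: for
`D : KatoExpPadicDatum hγ Φ`, `t·t′ = π^{m₀}`, (tf), (rk), characters of every primitive level, continuations and generic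
non-vanishing: `(π^{m₀}·C(2N(α))) • EU_𝔟 = ((D.cZ·t′)·D.xTilde 𝔟) • 𝐳_{γ′}` for EVERY admissible `𝔟` —
`TwoSidedComparisonShape Φ D.xTilde s c` with `s = π^{m₀}·C(2(α₀² + 7α₁²))` and `c = D.cZ·t′` NAMED.  Value agreement (block
(A) kernels with `Λ`-valued coefficients `C α₀, C α₁` read by `ι₇`) + the PROVED rank-one separation ((S-Λ), (S-ev), (S-N)).
CONDITIONAL; nothing asserted; 19945 OPEN.
[cite: Kato2004Asterisque, (15.16.1) (p. 265) "By (15.12.2) and Thm. 12.4 (2)", Prop. 15.9 (p. 258), Thm. 12.5 (1) (p. 221), §13.9 (p. 230), 13.5 (p. 227)] -/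
theorem twoSidedComparisonShape_of_katoExpPadicDatum (hγ : K.IsTopGenerator γ) (Φ : PinnedKatoGenusFrame W K hK I d)
    (D : KatoExpPadicDatum hγ Φ) (t' : Φ.R) (m₀ : ℕ) (ht : Φ.t * t' = Φ.π ^ m₀)
    (htf : ∀ (f : IwasawaAlgebra 7) (x : Φ.IK.H), f ≠ 0 → f • x = 0 → x = 0)
    (hrk : ∀ x y : Φ.IK.H, ∃ s r₀ r₁ : IwasawaAlgebra 7,
      (s ≠ 0 ∨ r₀ ≠ 0 ∨ r₁ ≠ 0) ∧ s • x = r₀ • y + r₁ • Φ.piK y)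
    (hχ : ∀ n : ℕ, ∃ χ : absoluteGaloisGroup Φ.Kcm →ₜ* ℂˣ,
      (∀ σ ∈ (K.restrictOfFinrankEqTwo (by decide) Φ.Kcm Φ.finrank_Kcm).layerSubgroup (n + 1), χ σ = 1) ∧
        IsPrimitiveRoot (((χ Φ.γK : ℂˣ)) : ℂ) (7 ^ (n + 1)))
    (hL : ∀ χ : absoluteGaloisGroup Φ.Kcm →ₜ* ℂˣ, ∃ Lf : ℂ → ℂ, CM.IsDepletedHeckeL Φ.ψ χ (7 * (7 * F.d)) Lf)
    (hRoh : ∃ n₁ : ℕ, ∀ n : ℕ, n₁ ≤ n → ∀ χ : absoluteGaloisGroup Φ.Kcm →ₜ* ℂˣ,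
      (∀ σ ∈ (K.restrictOfFinrankEqTwo (by decide) Φ.Kcm Φ.finrank_Kcm).layerSubgroup (n + 1), χ σ = 1) →
      IsPrimitiveRoot (((χ Φ.γK : ℂˣ)) : ℂ) (7 ^ (n + 1)) →
      ∀ Lf : ℂ → ℂ, CM.IsDepletedHeckeL Φ.ψ χ (7 * (7 * F.d)) Lf → Lf 1 ≠ 0) :
    TwoSidedComparisonShape Φ D.xTilde
      (Φ.π ^ m₀ * algebraMap (IwasawaAlgebra 7) Φ.R (PowerSeries.C (2 * (D.α₀ ^ 2 + 7 * D.α₁ ^ 2))))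
      (D.cZ * t') := by
  classical
  obtain ⟨n₁, hn₁⟩ := hRoh
  intro 𝔟 h𝔟
  obtain ⟨s, r₀, r₁, hne, hdep⟩ := hrk (Φ.euK 𝔟) D.zStar
  -- opaque names for the explicit data
  obtain ⟨b₀, hb₀def⟩ : ∃ b : ℤ, b = D.bCoef₀ 𝔟 := ⟨_, rfl⟩
  obtain ⟨b₁, hb₁def⟩ : ∃ b : ℤ, b = D.bCoef₁ 𝔟 := ⟨_, rfl⟩
  have hb : 2 * CM.heckeCharIdealValue Φ.ψ 𝔟 =
      (b₀ : ℂ) + (b₁ : ℂ) * Φ.ιC (algebraMap Φ.Kcm (AlgebraicClosure Φ.Kcm) Φ.sqrtNegSeven) := by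
    rw [hb₀def, hb₁def]; exact D.psi_eq 𝔟 h𝔟
  obtain ⟨q, hqdef⟩ : ∃ q : ℂ, q = Φ.ιC (algebraMap Φ.Kcm (AlgebraicClosure Φ.Kcm) Φ.sqrtNegSeven) := ⟨_, rfl⟩
  have hq : q ^ 2 = -7 := by rw [hqdef]; exact Φ.ιC_sqrtNegSeven_sq
  obtain ⟨P, hPdef⟩ : ∃ P : IwasawaAlgebra 7, P = D.sigma 𝔟 := ⟨_, rfl⟩
  obtain ⟨c₁, hc₁⟩ : ∃ c : ℤ, c = 7 ^ D.e := ⟨_, rfl⟩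
  obtain ⟨N, hNdef⟩ : ∃ N : ℕ, N = Ideal.absNorm 𝔟 := ⟨_, rfl⟩
  obtain ⟨A₀, hA₀def⟩ : ∃ A : IwasawaAlgebra 7, A = PowerSeries.C D.α₀ := ⟨_, rfl⟩
  obtain ⟨A₁, hA₁def⟩ : ∃ A : IwasawaAlgebra 7, A = PowerSeries.C D.α₁ := ⟨_, rfl⟩
  obtain ⟨g₀, hg₀⟩ : ∃ g : IwasawaAlgebra 7, g = (c₁ : IwasawaAlgebra 7) * s *
      (((2 * N : ℕ) : ℤ) - (b₀ : IwasawaAlgebra 7) * P) - 2 * (A₀ * r₀ - 7 * A₁ * r₁) := ⟨_, rfl⟩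
  obtain ⟨g₁, hg₁⟩ : ∃ g : IwasawaAlgebra 7, g = -((c₁ : IwasawaAlgebra 7) * (b₁ : IwasawaAlgebra 7) * s * P) -
    2 * (A₁ * r₀ + A₀ * r₁) := ⟨_, rfl⟩
  -- STEP 1 (values ⇒ divisibility): `Φ_{7^{n+1}}(1+X) ∣ g₀² + 7g₁²` for every `n ≥ max n₀ n₁`
  have hdiv : ∀ n : ℕ, max D.n₀ n₁ ≤ n →
      ((((cyclotomic (7 ^ (n + 1)) ℤ).comp (X + 1)).map (Int.castRingHom ℤ_[7]) : ℤ_[7][X]) : IwasawaAlgebra 7) ∣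
        (g₀ * g₀ + ((7 : ℤ) : IwasawaAlgebra 7) * (g₁ * g₁)) := by
    intro n hn
    obtain ⟨χ, hχU, hprim⟩ := hχ n
    obtain ⟨Lf, hLf⟩ := hL χ
    have hL1 : Lf 1 ≠ 0 := hn₁ n (le_of_max_le_right hn) χ hχU hprim Lf hLf
    obtain ⟨u, hudef⟩ : ∃ u : ℂ, u = ((((χ Φ.γK)⁻¹ : ℂˣ)) : ℂ) := ⟨_, rfl⟩
    have hu : u ^ 7 ^ (n + 1) = 1 := by rw [hudef]; exact Φ.inv_chi_γK_pow_eq_one χ hχU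
    have hprimu : IsPrimitiveRoot u (7 ^ (n + 1)) := by
      rw [hudef, Units.val_inv_eq_inv_val]; exact hprim.inv
    have hT : ∀ m : Φ.IK.H, D.val χ ((1 + PowerSeries.X : IwasawaAlgebra 7) • m) = u * D.val χ m := by
      intro m; rw [hudef]; exact D.val_T χ ⟨n + 1, hχU⟩ m
    have hC : ∀ (c : ℤ_[7]) (m : Φ.IK.H), D.val χ ((PowerSeries.C c : IwasawaAlgebra 7) • m) =
        (D.ι₇.comp (algebraMap ℤ_[7] ℚ_[7])) c * D.val χ m := fun c m => D.val_C χ ⟨n + 1, hχU⟩ c m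
    have hval : ∀ (f : IwasawaAlgebra 7) (m : Φ.IK.H),
        D.val χ (f • m) = charEval 7 (D.ι₇.comp (algebraMap ℤ_[7] ℚ_[7])) u (n + 1) f * D.val χ m :=
      fun f m => val_smul_eq_charEval_mul hT hC hu f m
    have hVZ : D.val χ D.zStar ≠ 0 := D.val_zStar_ne_zero (le_of_max_le_left hn) χ hχU hprim hLf hL1
    -- the ★-coefficients `A₀ = C α₀`, `A₁ = C α₁` act on values by `ι₇ α₀`, `ι₇ α₁` ((e1′))
    have hA₀ : ∀ m : Φ.IK.H, D.val χ (A₀ • m) = D.ι₇ (D.α₀ : ℚ_[7]) * D.val χ m := by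
      intro m; rw [hA₀def]; exact D.val_C χ ⟨n + 1, hχU⟩ D.α₀ m
    have hA₁ : ∀ m : Φ.IK.H, D.val χ (A₁ • m) = D.ι₇ (D.α₁ : ℚ_[7]) * D.val χ m := by
      intro m; rw [hA₁def]; exact D.val_C χ ⟨n + 1, hχU⟩ D.α₁ m
    -- (art) LEVEL-WISE: a natural lift `a ≡ κ(𝔟) (mod 7^{n+1})`, `χ(𝔟)⁻¹ = u^a`, `σ_𝔟` acts by `u^a` at this level
    obtain ⟨a, ha⟩ := D.exists_nat_toZModPow_artExp 𝔟 (n + 1)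
    have hw : (heckeIdealValue χ 𝔟)⁻¹ = u ^ a := by
      rw [hudef]; exact D.inv_heckeIdealValue_eq_pow χ hχU h𝔟 ha
    have hE : D.val χ (Φ.euK 𝔟) =
        ((N : ℂ) - CM.heckeCharIdealValue Φ.ψ 𝔟 * u ^ a) * (Φ.Ω⁻¹ * Lf 1) := by
      rw [D.val_euK 𝔟 h𝔟 (n + 1) χ hχU Lf hLf, hw, hNdef, mul_assoc]
    have hZ : (c₁ : ℂ) * D.val χ D.zStar =
        (D.ι₇ (D.α₀ : ℚ_[7]) + D.ι₇ (D.α₁ : ℚ_[7]) * q) * (Φ.Ω⁻¹ * Lf 1) := by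
      rw [hc₁, hqdef]; push_cast
      rw [D.val_zStar n (le_of_max_le_left hn) χ hχU hprim Lf hLf, mul_assoc]
    have hbq : 2 * CM.heckeCharIdealValue Φ.ψ 𝔟 = (b₀ : ℂ) + (b₁ : ℂ) * q := by rw [hqdef]; exact hb
    have hvpi : ∀ y : Φ.IK.H, D.val χ (Φ.piK y) = q * D.val χ y := by
      intro y; rw [hqdef]; exact D.val_piK χ ⟨n + 1, hχU⟩ y
    have hM : Φ.Ω⁻¹ * Lf 1 ≠ 0 := mul_ne_zero (inv_ne_zero Φ.Ω_ne_zero) hL1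
    have hPval : ∀ m : Φ.IK.H, D.val χ (P • m) = u ^ a * D.val χ m := by
      intro m; rw [hPdef, hudef]; exact D.val_sigma_smul_eq_pow χ hχU 𝔟 ha m
    have hev0 := ev_normForm_eq_zero_C Φ.piK (D.val χ) (charEval 7 (D.ι₇.comp (algebraMap ℤ_[7] ℚ_[7])) u (n + 1))
      hval Φ.piK_smul hq hvpi (D.val_intCast_smul χ ⟨n + 1, hχU⟩) hA₀ hA₁ hPval hdep hE hZ hbq hM hVZ hg₀ hg₁
    exact coe_cyclotomic_comp_dvd_of_charEval_eq_zero 7 n D.ι₇ hprimu hev0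
  -- STEP 1′ (separation + norm trick): `g₀ = g₁ = 0`
  have hzero : g₀ * g₀ + ((7 : ℤ) : IwasawaAlgebra 7) * (g₁ * g₁) = 0 := by
    refine eq_zero_of_infinite_setOf_cyclotomic_dvd 7 (Set.infinite_of_not_bddAbove ?_)
    rw [not_bddAbove_iff]
    intro m
    exact ⟨max (max D.n₀ n₁) (m + 1), hdiv _ (le_max_left _ _), lt_of_lt_of_le (Nat.lt_succ_self m) (le_max_right _ _)⟩
  have hg : g₀ = 0 ∧ g₁ = 0 := by
    refine eq_zero_of_sq_add_C_mul_sq_eq_zero 7 ?_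
    rw [map_natCast, sq, sq]
    push_cast at hzero
    exact hzero
  obtain ⟨hg₀0, hg₁0⟩ := hg
  have G0 : (c₁ : IwasawaAlgebra 7) * s * (((2 * N : ℕ) : ℤ) - (b₀ : IwasawaAlgebra 7) * P) =
      2 * (A₀ * r₀ - 7 * A₁ * r₁) := by
    rw [← sub_eq_zero, ← hg₀]; exact hg₀0
  have G1 : -((c₁ : IwasawaAlgebra 7) * (b₁ : IwasawaAlgebra 7) * s * P) = 2 * (A₁ * r₀ + A₀ * r₁) := by
    rw [← sub_eq_zero, ← hg₁]; exact hg₁0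
  -- STEP 2 (module identity in `Φ.IK.H`)
  have h2 : (2 : IwasawaAlgebra 7) ≠ 0 := by
    have := intCast_iwasawaAlgebra_ne_zero (n := 2) (by norm_num); push_cast at this; exact this
  have hNΛ : A₀ ^ 2 + 7 * A₁ ^ 2 ≠ 0 := by
    rw [hA₀def, hA₁def]; exact D.C_sq_add_seven_mul_C_sq_ne_zero
  have hs : s ≠ 0 := by
    intro hs0
    rw [hs0] at G0 G1
    obtain ⟨hr₀, hr₁⟩ := r_eq_zero_of_s_eq_zero_C h2 hNΛ G0 G1
    rcases hne with h | h | h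
    · exact h hs0
    · exact h hr₀
    · exact h hr₁
  have hpiK_sq : ∀ y : Φ.IK.H, Φ.piK (Φ.piK y) = ((-7 : ℤ) : IwasawaAlgebra 7) • y := fun y => by
    rw [Φ.piK_piK, Int.cast_smul_eq_zsmul]
  have hmod := module_identity_C Φ.piK Φ.piK_smul hpiK_sq htf hs hdep G0 G1
  -- STEP 3 (transport through `ιS` and the two-sided form)
  have hιZ := iotaS_eq_of_unit_smul Φ.ιS Φ.π D.uStar
    (by rw [D.uStar_smul_zStar]; exact (Φ.j_apply hγ Φ.zOne).symm) Φ.k Φ.a Φ.u Φ.j_zOne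
  have hEU : (2 * (A₀ ^ 2 + 7 * A₁ ^ 2)) • Φ.frame.EU 𝔟 =
      ((((algebraMap (IwasawaAlgebra 7) Φ.R A₀ - algebraMap (IwasawaAlgebra 7) Φ.R A₁ * Φ.π) *
          algebraMap (IwasawaAlgebra 7) Φ.R (c₁ : IwasawaAlgebra 7)) *
        (algebraMap (IwasawaAlgebra 7) Φ.R ((((2 * N : ℕ) : ℤ) : IwasawaAlgebra 7) - (b₀ : IwasawaAlgebra 7) * P) -
          algebraMap (IwasawaAlgebra 7) Φ.R (b₁ : IwasawaAlgebra 7) * algebraMap (IwasawaAlgebra 7) Φ.R P * Φ.π)) *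
        (algebraMap (IwasawaAlgebra 7) Φ.R (↑(D.uStar⁻¹) : IwasawaAlgebra 7) *
          (algebraMap (IwasawaAlgebra 7) Φ.R ((7 : IwasawaAlgebra 7) ^ Φ.k) * ((Φ.u : Φ.R) * Φ.π ^ Φ.a)))) • Φ.zS := by
    rw [Φ.EU_eq 𝔟 h𝔟, ← map_smul, hmod, iotaS_transport Φ.ιS Φ.π Φ.piK Φ.ιS_piK Φ.piK_smul, hιZ, smul_smul]
  have h2s := twoSided_of_smul_eq Φ.π _ _ _ _ Φ.zeta_eq ht hEU
  subst hb₀def hb₁def hPdef hc₁ hNdef hA₀def hA₁def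
  rw [← D.two_mul_C_sq_add_eq]
  exact h2s

/-- ★′ **THE PERIOD-SCALED COMPARISON WITH EXPLICIT CONSTANTS, FROM ITS INPUTS, 7-ADIC ★-CONSTANTS**:
`π^{m₀ + 2jα} • EU_𝔟 = ((wα⁻¹·(D.cZ·t′))·D.xTilde 𝔟) • 𝐳_{γ′}` — `PeriodScaledComparisonShape Φ D.xTilde n c` with
`n = m₀ + 2·v₇(α₀² + 7α₁²)` and `c = wα⁻¹·D.cZ·t′` NAMED.  CONDITIONAL; nothing asserted; 19945 OPEN.
[cite: Kato2004Asterisque, (15.16.1) (p. 265), Thm. 12.4 (2) (p. 221)] -/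
theorem periodScaledComparisonShape_of_katoExpPadicDatum (hγ : K.IsTopGenerator γ)
    (Φ : PinnedKatoGenusFrame W K hK I d) (D : KatoExpPadicDatum hγ Φ) (t' : Φ.R) (m₀ : ℕ) (ht : Φ.t * t' = Φ.π ^ m₀)
    (htf : ∀ (f : IwasawaAlgebra 7) (x : Φ.IK.H), f ≠ 0 → f • x = 0 → x = 0)
    (hrk : ∀ x y : Φ.IK.H, ∃ s r₀ r₁ : IwasawaAlgebra 7,
      (s ≠ 0 ∨ r₀ ≠ 0 ∨ r₁ ≠ 0) ∧ s • x = r₀ • y + r₁ • Φ.piK y)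
    (hχ : ∀ n : ℕ, ∃ χ : absoluteGaloisGroup Φ.Kcm →ₜ* ℂˣ,
      (∀ σ ∈ (K.restrictOfFinrankEqTwo (by decide) Φ.Kcm Φ.finrank_Kcm).layerSubgroup (n + 1), χ σ = 1) ∧
        IsPrimitiveRoot (((χ Φ.γK : ℂˣ)) : ℂ) (7 ^ (n + 1)))
    (hL : ∀ χ : absoluteGaloisGroup Φ.Kcm →ₜ* ℂˣ, ∃ Lf : ℂ → ℂ, CM.IsDepletedHeckeL Φ.ψ χ (7 * (7 * F.d)) Lf)
    (hRoh : ∃ n₁ : ℕ, ∀ n : ℕ, n₁ ≤ n → ∀ χ : absoluteGaloisGroup Φ.Kcm →ₜ* ℂˣ,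
      (∀ σ ∈ (K.restrictOfFinrankEqTwo (by decide) Φ.Kcm Φ.finrank_Kcm).layerSubgroup (n + 1), χ σ = 1) →
      IsPrimitiveRoot (((χ Φ.γK : ℂˣ)) : ℂ) (7 ^ (n + 1)) →
      ∀ Lf : ℂ → ℂ, CM.IsDepletedHeckeL Φ.ψ χ (7 * (7 * F.d)) Lf → Lf 1 ≠ 0) :
    PeriodScaledComparisonShape Φ D.xTilde (m₀ + 2 * D.jα) ((↑(D.isUnit_wα.unit⁻¹) : Φ.R) * (D.cZ * t')) :=
  (twoSidedComparisonShape_of_katoExpPadicDatum hγ Φ D t' m₀ ht htf hrk hχ hL hRoh).periodScaled D.isUnit_wα.unit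
    (m₀ + 2 * D.jα) (by rw [IsUnit.unit_spec]; exact D.sTwoSided_eq m₀)

set_option maxHeartbeats 400000 in
/-- **`RationalComparisonShape Φ` FROM ITS INPUTS, 7-ADIC ★-CONSTANTS** ((P3) currency; constants forgotten).
CONDITIONAL; nothing asserted; 19945 OPEN. [cite: Kato2004Asterisque, (15.16.1) (p. 265), Thm. 12.4 (2) (p. 221)] -/
theorem rationalComparisonShape_of_katoExpPadicCompat (hγ : K.IsTopGenerator γ) (Φ : PinnedKatoGenusFrame W K hK I d)
    (hD : KatoExpPadicCompatShape hγ Φ)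
    (ht : ∃ (t' : Φ.R) (m₀ : ℕ), Φ.t * t' = Φ.π ^ m₀)
    (htf : ∀ (f : IwasawaAlgebra 7) (x : Φ.IK.H), f ≠ 0 → f • x = 0 → x = 0)
    (hrk : ∀ x y : Φ.IK.H, ∃ s r₀ r₁ : IwasawaAlgebra 7,
      (s ≠ 0 ∨ r₀ ≠ 0 ∨ r₁ ≠ 0) ∧ s • x = r₀ • y + r₁ • Φ.piK y)
    (hχ : ∀ n : ℕ, ∃ χ : absoluteGaloisGroup Φ.Kcm →ₜ* ℂˣ,
      (∀ σ ∈ (K.restrictOfFinrankEqTwo (by decide) Φ.Kcm Φ.finrank_Kcm).layerSubgroup (n + 1), χ σ = 1) ∧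
        IsPrimitiveRoot (((χ Φ.γK : ℂˣ)) : ℂ) (7 ^ (n + 1)))
    (hL : ∀ χ : absoluteGaloisGroup Φ.Kcm →ₜ* ℂˣ, ∃ Lf : ℂ → ℂ, CM.IsDepletedHeckeL Φ.ψ χ (7 * (7 * F.d)) Lf)
    (hRoh : ∃ n₁ : ℕ, ∀ n : ℕ, n₁ ≤ n → ∀ χ : absoluteGaloisGroup Φ.Kcm →ₜ* ℂˣ,
      (∀ σ ∈ (K.restrictOfFinrankEqTwo (by decide) Φ.Kcm Φ.finrank_Kcm).layerSubgroup (n + 1), χ σ = 1) →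
      IsPrimitiveRoot (((χ Φ.γK : ℂˣ)) : ℂ) (7 ^ (n + 1)) →
      ∀ Lf : ℂ → ℂ, CM.IsDepletedHeckeL Φ.ψ χ (7 * (7 * F.d)) Lf → Lf 1 ≠ 0) :
    RationalComparisonShape Φ := by
  obtain ⟨D⟩ := hD
  obtain ⟨t', m₀, htt⟩ := ht
  exact (periodScaledComparisonShape_of_katoExpPadicDatum hγ Φ D t' m₀ htt htf hrk hχ hL hRoh).rational

/-! ## §F  (KI)-R over `KatoExpPadicDatum`: `IntegralComparisonShape Φ` at one frame; ★ the assembly with EXACTLY the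
statement of the tree's `integralComparisonSeven_of_katoExpInputs` under `KatoExpDatum ↦ KatoExpPadicDatum` (pen D1086 (c2))
and the kernel-visible junction; «K2cPinned» -/

/-- **The K2ᶜ input form at ONE pinned frame ⇒ `IntegralComparisonShape Φ`**, 7-adic ★-constants (★′ + the divisibility of
its explicit constant + `integralComparisonShape_of_periodScaled_of_dvd`).  CONDITIONAL; nothing asserted; 19945 OPEN.
[cite: Kato2004Asterisque, (15.16.1) (p. 265), 15.14 (p. 264), Thm. 12.4 (2) (p. 221)] -/
theorem integralComparisonShape_of_katoExpPadicDatum (hγ : K.IsTopGenerator γ) (Φ : PinnedKatoGenusFrame W K hK I d)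
    (D : KatoExpPadicDatum hγ Φ) (t' : Φ.R) (m₀ : ℕ) (ht : Φ.t * t' = Φ.π ^ m₀)
    (htf : ∀ (f : IwasawaAlgebra 7) (x : Φ.IK.H), f ≠ 0 → f • x = 0 → x = 0)
    (hrk : ∀ x y : Φ.IK.H, ∃ s r₀ r₁ : IwasawaAlgebra 7,
      (s ≠ 0 ∨ r₀ ≠ 0 ∨ r₁ ≠ 0) ∧ s • x = r₀ • y + r₁ • Φ.piK y)
    (hχ : ∀ n : ℕ, ∃ χ : absoluteGaloisGroup Φ.Kcm →ₜ* ℂˣ,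
      (∀ σ ∈ (K.restrictOfFinrankEqTwo (by decide) Φ.Kcm Φ.finrank_Kcm).layerSubgroup (n + 1), χ σ = 1) ∧
        IsPrimitiveRoot (((χ Φ.γK : ℂˣ)) : ℂ) (7 ^ (n + 1)))
    (hL : ∀ χ : absoluteGaloisGroup Φ.Kcm →ₜ* ℂˣ, ∃ Lf : ℂ → ℂ, CM.IsDepletedHeckeL Φ.ψ χ (7 * (7 * F.d)) Lf)
    (hRoh : ∃ n₁ : ℕ, ∀ n : ℕ, n₁ ≤ n → ∀ χ : absoluteGaloisGroup Φ.Kcm →ₜ* ℂˣ,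
      (∀ σ ∈ (K.restrictOfFinrankEqTwo (by decide) Φ.Kcm Φ.finrank_Kcm).layerSubgroup (n + 1), χ σ = 1) →
      IsPrimitiveRoot (((χ Φ.γK : ℂˣ)) : ℂ) (7 ^ (n + 1)) →
      ∀ Lf : ℂ → ℂ, CM.IsDepletedHeckeL Φ.ψ χ (7 * (7 * F.d)) Lf → Lf 1 ≠ 0)
    (hKI : Φ.π ^ (m₀ + 2 * D.jα) ∣ D.cZ * t') :
    IntegralComparisonShape Φ :=
  integralComparisonShape_of_periodScaled_of_dvd Φ
    (periodScaledComparisonShape_of_katoExpPadicDatum hγ Φ D t' m₀ ht htf hrk hχ hL hRoh) (hKI.mul_left _)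

/-- **Unit-`t` gauge**: `hKI` replaced by `IsUnit Φ.t` and `jα ≤ 2e + 2k + a` (the (PK) predicate `PeriodPositionField`
UNFOLDED, pen D1086 (c3)).  CONDITIONAL; nothing asserted; 19945 OPEN.
[cite: Kato2004Asterisque, (15.16.1) (p. 265), 15.14 (p. 264), Thm. 12.4 (2) (p. 221)] -/
theorem integralComparisonShape_of_katoExpPadicDatum_of_le (hγ : K.IsTopGenerator γ)
    (Φ : PinnedKatoGenusFrame W K hK I d) (D : KatoExpPadicDatum hγ Φ) (t' : Φ.R) (m₀ : ℕ) (ht : Φ.t * t' = Φ.π ^ m₀)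
    (htf : ∀ (f : IwasawaAlgebra 7) (x : Φ.IK.H), f ≠ 0 → f • x = 0 → x = 0)
    (hrk : ∀ x y : Φ.IK.H, ∃ s r₀ r₁ : IwasawaAlgebra 7,
      (s ≠ 0 ∨ r₀ ≠ 0 ∨ r₁ ≠ 0) ∧ s • x = r₀ • y + r₁ • Φ.piK y)
    (hχ : ∀ n : ℕ, ∃ χ : absoluteGaloisGroup Φ.Kcm →ₜ* ℂˣ,
      (∀ σ ∈ (K.restrictOfFinrankEqTwo (by decide) Φ.Kcm Φ.finrank_Kcm).layerSubgroup (n + 1), χ σ = 1) ∧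
        IsPrimitiveRoot (((χ Φ.γK : ℂˣ)) : ℂ) (7 ^ (n + 1)))
    (hL : ∀ χ : absoluteGaloisGroup Φ.Kcm →ₜ* ℂˣ, ∃ Lf : ℂ → ℂ, CM.IsDepletedHeckeL Φ.ψ χ (7 * (7 * F.d)) Lf)
    (hRoh : ∃ n₁ : ℕ, ∀ n : ℕ, n₁ ≤ n → ∀ χ : absoluteGaloisGroup Φ.Kcm →ₜ* ℂˣ,
      (∀ σ ∈ (K.restrictOfFinrankEqTwo (by decide) Φ.Kcm Φ.finrank_Kcm).layerSubgroup (n + 1), χ σ = 1) →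
      IsPrimitiveRoot (((χ Φ.γK : ℂˣ)) : ℂ) (7 ^ (n + 1)) →
      ∀ Lf : ℂ → ℂ, CM.IsDepletedHeckeL Φ.ψ χ (7 * (7 * F.d)) Lf → Lf 1 ≠ 0)
    (htu : IsUnit Φ.t) (hPP : D.jα ≤ 2 * D.e + 2 * Φ.k + Φ.a) :
    IntegralComparisonShape Φ :=
  integralComparisonShape_of_katoExpPadicDatum hγ Φ D t' m₀ ht htf hrk hχ hL hRoh
    (D.pow_dvd_cZ_mul_of_le t' _ m₀ (PeriodPosition.cofactor_eq_of_isUnit ht htu) hPP)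

/-- **General gauge**: `hKI` replaced by a factorisation `t′ = w′·π^{m′}` and `m₀ + jα ≤ 2e + 2k + a + m′` (the (PK)
predicate `PeriodPositionFieldAt` UNFOLDED).  CONDITIONAL; nothing asserted; 19945 OPEN.
[cite: Kato2004Asterisque, (15.16.1) (p. 265), 15.14 (p. 264), Thm. 12.4 (2) (p. 221)] -/
theorem integralComparisonShape_of_katoExpPadicDatum_of_leAt (hγ : K.IsTopGenerator γ)
    (Φ : PinnedKatoGenusFrame W K hK I d) (D : KatoExpPadicDatum hγ Φ) (t' : Φ.R) (m₀ : ℕ) (ht : Φ.t * t' = Φ.π ^ m₀)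
    (htf : ∀ (f : IwasawaAlgebra 7) (x : Φ.IK.H), f ≠ 0 → f • x = 0 → x = 0)
    (hrk : ∀ x y : Φ.IK.H, ∃ s r₀ r₁ : IwasawaAlgebra 7,
      (s ≠ 0 ∨ r₀ ≠ 0 ∨ r₁ ≠ 0) ∧ s • x = r₀ • y + r₁ • Φ.piK y)
    (hχ : ∀ n : ℕ, ∃ χ : absoluteGaloisGroup Φ.Kcm →ₜ* ℂˣ,
      (∀ σ ∈ (K.restrictOfFinrankEqTwo (by decide) Φ.Kcm Φ.finrank_Kcm).layerSubgroup (n + 1), χ σ = 1) ∧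
        IsPrimitiveRoot (((χ Φ.γK : ℂˣ)) : ℂ) (7 ^ (n + 1)))
    (hL : ∀ χ : absoluteGaloisGroup Φ.Kcm →ₜ* ℂˣ, ∃ Lf : ℂ → ℂ, CM.IsDepletedHeckeL Φ.ψ χ (7 * (7 * F.d)) Lf)
    (hRoh : ∃ n₁ : ℕ, ∀ n : ℕ, n₁ ≤ n → ∀ χ : absoluteGaloisGroup Φ.Kcm →ₜ* ℂˣ,
      (∀ σ ∈ (K.restrictOfFinrankEqTwo (by decide) Φ.Kcm Φ.finrank_Kcm).layerSubgroup (n + 1), χ σ = 1) →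
      IsPrimitiveRoot (((χ Φ.γK : ℂˣ)) : ℂ) (7 ^ (n + 1)) →
      ∀ Lf : ℂ → ℂ, CM.IsDepletedHeckeL Φ.ψ χ (7 * (7 * F.d)) Lf → Lf 1 ≠ 0)
    (w' : Φ.R) (m' : ℕ) (ht' : t' = w' * Φ.π ^ m') (hPP : m₀ + D.jα ≤ 2 * D.e + 2 * Φ.k + Φ.a + m') :
    IntegralComparisonShape Φ :=
  integralComparisonShape_of_katoExpPadicDatum hγ Φ D t' m₀ ht htf hrk hχ hL hRoh
    (D.pow_dvd_cZ_mul_of_leAt t' w' m₀ m' ht' hPP)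

end Frame

/-- ★ **`integralComparisonSeven_of_katoExpPadicInputs` — THE PINNED INTEGRAL COMPARISON FROM THE K2ᶜ INPUT FORM OVER
`KatoExpPadicDatum`**: EXACTLY the statement of the tree's `GenusSeven.integralComparisonSeven_of_katoExpInputs`
(`RamifiedSevenIntegralComparisonOfInputsR.lean`, p801395) with `KatoExpDatum ↦ KatoExpPadicDatum` in the hypothesis and the
SAME conclusion (pen D1086 (c2)); the junction `example`s below derive the tree's conclusion from it in the kernel.
CONDITIONAL; nothing asserted; no stub closes; 19945 OPEN; BSD claimed for no curve.
[cite: Kato2004Asterisque, §15.16 (15.16.1) (p. 265), 15.14 (p. 264), Prop. 15.9 (p. 258), Thm. 12.4 (2) / 12.5 (1) (p. 221), 13.5 (p. 227)] -/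
theorem integralComparisonSeven_of_katoExpPadicInputs
    (h : exists_zetaClassPosition_of_rank_le_one → rank_eq_analyticRank_of_analyticRank_le_one →
      ∀ (W : WeierstrassCurve ℚ) [W.IsElliptic] [W.IsGloballyMinimal] [Fact (Nat.Prime 7)], X12.ClassCSeven W →
      letI : ContinuousSMul ℤ_[7] (W.tateModule 7) := TateModule.continuousSMul_padicInt
      ∀ (K : ZpExtension ℚ 7) (hK : K.IsCyclotomic) (γ : Field.absoluteGaloisGroup ℚ) (hγ : K.IsTopGenerator γ)
        (I : IwasawaH1Data W 7 K γ),
        ∃ (F : GenusFrame) (θu : ∀ n : ℕ, globalUnitsOf (F.layer n)), IsNormedEllipticUnitFamily F θu ∧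
          ∀ d : GenusDatum F θu, ∃ Φ : PinnedKatoGenusFrame W K hK I d, ∃ D : KatoExpPadicDatum hγ Φ,
            ∃ (t' : Φ.R) (m₀ : ℕ), Φ.t * t' = Φ.π ^ m₀ ∧
            (∀ (f : IwasawaAlgebra 7) (x : Φ.IK.H), f ≠ 0 → f • x = 0 → x = 0) ∧
            (∀ x y : Φ.IK.H, ∃ s r₀ r₁ : IwasawaAlgebra 7,
              (s ≠ 0 ∨ r₀ ≠ 0 ∨ r₁ ≠ 0) ∧ s • x = r₀ • y + r₁ • Φ.piK y) ∧
            (∀ n : ℕ, ∃ χ : absoluteGaloisGroup Φ.Kcm →ₜ* ℂˣ,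
              (∀ σ ∈ (K.restrictOfFinrankEqTwo (by decide) Φ.Kcm Φ.finrank_Kcm).layerSubgroup (n + 1), χ σ = 1) ∧
                IsPrimitiveRoot (((χ Φ.γK : ℂˣ)) : ℂ) (7 ^ (n + 1))) ∧
            (∀ χ : absoluteGaloisGroup Φ.Kcm →ₜ* ℂˣ, ∃ Lf : ℂ → ℂ, CM.IsDepletedHeckeL Φ.ψ χ (7 * (7 * F.d)) Lf) ∧
            (∃ n₁ : ℕ, ∀ n : ℕ, n₁ ≤ n → ∀ χ : absoluteGaloisGroup Φ.Kcm →ₜ* ℂˣ,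
              (∀ σ ∈ (K.restrictOfFinrankEqTwo (by decide) Φ.Kcm Φ.finrank_Kcm).layerSubgroup (n + 1), χ σ = 1) →
              IsPrimitiveRoot (((χ Φ.γK : ℂˣ)) : ℂ) (7 ^ (n + 1)) →
              ∀ Lf : ℂ → ℂ, CM.IsDepletedHeckeL Φ.ψ χ (7 * (7 * F.d)) Lf → Lf 1 ≠ 0) ∧
            Φ.π ^ (m₀ + 2 * D.jα) ∣ D.cZ * t') :
    Kato2004.exists_zetaClassPosition_of_rank_le_one → rank_eq_analyticRank_of_analyticRank_le_one →
    ∀ (W : WeierstrassCurve ℚ) [W.IsElliptic] [W.IsGloballyMinimal] [Fact (Nat.Prime 7)], X12.ClassCSeven W →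
      letI : ContinuousSMul ℤ_[7] (W.tateModule 7) := TateModule.continuousSMul_padicInt
      ∀ (K : ZpExtension ℚ 7) (hK : K.IsCyclotomic) (γ : Field.absoluteGaloisGroup ℚ) (_ : K.IsTopGenerator γ)
        (I : IwasawaH1Data W 7 K γ),
        ∃ (F : GenusSeven.GenusFrame) (θu : ∀ n : ℕ, globalUnitsOf (F.layer n)), GenusSeven.IsNormedEllipticUnitFamily F θu ∧
          ∀ d : GenusSeven.GenusDatum F θu, ∃ Φ : GenusSeven.PinnedKatoGenusFrame W K hK I d,
            GenusSeven.IntegralComparisonShape Φ := by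
  intro hstar hGZK W _ _ _ hC K hK γ hγ I
  haveI : ContinuousSMul ℤ_[7] (W.tateModule 7) := TateModule.continuousSMul_padicInt
  obtain ⟨F, θu, hpin, hΦ⟩ := h hstar hGZK W hC K hK γ hγ I
  refine ⟨F, θu, hpin, fun d => ?_⟩
  obtain ⟨Φ, D, t', m₀, ht, htf, hrk, hχ, hL, hRoh, hKI⟩ := hΦ d
  exact ⟨Φ, integralComparisonShape_of_katoExpPadicDatum hγ Φ D t' m₀ ht htf hrk hχ hL hRoh hKI⟩

/-- JUNCTION (pen D1086 (c2), kernel-visible): the conclusion of ★ IS the conclusion of the tree's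
`GenusSeven.integralComparisonSeven_of_katoExpInputs` — the two theorems have one and the same conclusion TYPE, so the K2ᶜ input
form over `KatoExpPadicDatum` feeds every consumer of the tree's letter (zp v17's `stub_integralComparisonSeven` included)
unchanged.  Nothing asserted. [cite: Kato2004Asterisque, §15.16 (15.16.1) (p. 265)] -/
example
    (h : exists_zetaClassPosition_of_rank_le_one → rank_eq_analyticRank_of_analyticRank_le_one →
      ∀ (W : WeierstrassCurve ℚ) [W.IsElliptic] [W.IsGloballyMinimal] [Fact (Nat.Prime 7)], X12.ClassCSeven W →
      letI : ContinuousSMul ℤ_[7] (W.tateModule 7) := TateModule.continuousSMul_padicInt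
      ∀ (K : ZpExtension ℚ 7) (hK : K.IsCyclotomic) (γ : Field.absoluteGaloisGroup ℚ) (hγ : K.IsTopGenerator γ)
        (I : IwasawaH1Data W 7 K γ),
        ∃ (F : GenusFrame) (θu : ∀ n : ℕ, globalUnitsOf (F.layer n)), IsNormedEllipticUnitFamily F θu ∧
          ∀ d : GenusDatum F θu, ∃ Φ : PinnedKatoGenusFrame W K hK I d, ∃ D : KatoExpPadicDatum hγ Φ,
            ∃ (t' : Φ.R) (m₀ : ℕ), Φ.t * t' = Φ.π ^ m₀ ∧
            (∀ (f : IwasawaAlgebra 7) (x : Φ.IK.H), f ≠ 0 → f • x = 0 → x = 0) ∧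
            (∀ x y : Φ.IK.H, ∃ s r₀ r₁ : IwasawaAlgebra 7,
              (s ≠ 0 ∨ r₀ ≠ 0 ∨ r₁ ≠ 0) ∧ s • x = r₀ • y + r₁ • Φ.piK y) ∧
            (∀ n : ℕ, ∃ χ : absoluteGaloisGroup Φ.Kcm →ₜ* ℂˣ,
              (∀ σ ∈ (K.restrictOfFinrankEqTwo (by decide) Φ.Kcm Φ.finrank_Kcm).layerSubgroup (n + 1), χ σ = 1) ∧
                IsPrimitiveRoot (((χ Φ.γK : ℂˣ)) : ℂ) (7 ^ (n + 1))) ∧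
            (∀ χ : absoluteGaloisGroup Φ.Kcm →ₜ* ℂˣ, ∃ Lf : ℂ → ℂ, CM.IsDepletedHeckeL Φ.ψ χ (7 * (7 * F.d)) Lf) ∧
            (∃ n₁ : ℕ, ∀ n : ℕ, n₁ ≤ n → ∀ χ : absoluteGaloisGroup Φ.Kcm →ₜ* ℂˣ,
              (∀ σ ∈ (K.restrictOfFinrankEqTwo (by decide) Φ.Kcm Φ.finrank_Kcm).layerSubgroup (n + 1), χ σ = 1) →
              IsPrimitiveRoot (((χ Φ.γK : ℂˣ)) : ℂ) (7 ^ (n + 1)) →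
              ∀ Lf : ℂ → ℂ, CM.IsDepletedHeckeL Φ.ψ χ (7 * (7 * F.d)) Lf → Lf 1 ≠ 0) ∧
            Φ.π ^ (m₀ + 2 * D.jα) ∣ D.cZ * t')
    (hv1 : exists_zetaClassPosition_of_rank_le_one → rank_eq_analyticRank_of_analyticRank_le_one →
      ∀ (W : WeierstrassCurve ℚ) [W.IsElliptic] [W.IsGloballyMinimal] [Fact (Nat.Prime 7)], X12.ClassCSeven W →
      letI : ContinuousSMul ℤ_[7] (W.tateModule 7) := TateModule.continuousSMul_padicInt
      ∀ (K : ZpExtension ℚ 7) (hK : K.IsCyclotomic) (γ : Field.absoluteGaloisGroup ℚ) (hγ : K.IsTopGenerator γ)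
        (I : IwasawaH1Data W 7 K γ),
        ∃ (F : GenusFrame) (θu : ∀ n : ℕ, globalUnitsOf (F.layer n)), IsNormedEllipticUnitFamily F θu ∧
          ∀ d : GenusDatum F θu, ∃ Φ : PinnedKatoGenusFrame W K hK I d, ∃ D : KatoExpDatum hγ Φ,
            ∃ (t' : Φ.R) (m₀ : ℕ), Φ.t * t' = Φ.π ^ m₀ ∧
            (∀ (f : IwasawaAlgebra 7) (x : Φ.IK.H), f ≠ 0 → f • x = 0 → x = 0) ∧
            (∀ x y : Φ.IK.H, ∃ s r₀ r₁ : IwasawaAlgebra 7,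
              (s ≠ 0 ∨ r₀ ≠ 0 ∨ r₁ ≠ 0) ∧ s • x = r₀ • y + r₁ • Φ.piK y) ∧
            (∀ n : ℕ, ∃ χ : absoluteGaloisGroup Φ.Kcm →ₜ* ℂˣ,
              (∀ σ ∈ (K.restrictOfFinrankEqTwo (by decide) Φ.Kcm Φ.finrank_Kcm).layerSubgroup (n + 1), χ σ = 1) ∧
                IsPrimitiveRoot (((χ Φ.γK : ℂˣ)) : ℂ) (7 ^ (n + 1))) ∧
            (∀ χ : absoluteGaloisGroup Φ.Kcm →ₜ* ℂˣ, ∃ Lf : ℂ → ℂ, CM.IsDepletedHeckeL Φ.ψ χ (7 * (7 * F.d)) Lf) ∧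
            (∃ n₁ : ℕ, ∀ n : ℕ, n₁ ≤ n → ∀ χ : absoluteGaloisGroup Φ.Kcm →ₜ* ℂˣ,
              (∀ σ ∈ (K.restrictOfFinrankEqTwo (by decide) Φ.Kcm Φ.finrank_Kcm).layerSubgroup (n + 1), χ σ = 1) →
              IsPrimitiveRoot (((χ Φ.γK : ℂˣ)) : ℂ) (7 ^ (n + 1)) →
              ∀ Lf : ℂ → ℂ, CM.IsDepletedHeckeL Φ.ψ χ (7 * (7 * F.d)) Lf → Lf 1 ≠ 0) ∧
            Φ.π ^ (m₀ + 2 * D.jα) ∣ D.cZ * t') :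
    -- the conclusion of ★ and the conclusion of the tree's theorem, as ONE proposition proved from either input form
    (Kato2004.exists_zetaClassPosition_of_rank_le_one → rank_eq_analyticRank_of_analyticRank_le_one →
    ∀ (W : WeierstrassCurve ℚ) [W.IsElliptic] [W.IsGloballyMinimal] [Fact (Nat.Prime 7)], X12.ClassCSeven W →
      letI : ContinuousSMul ℤ_[7] (W.tateModule 7) := TateModule.continuousSMul_padicInt
      ∀ (K : ZpExtension ℚ 7) (hK : K.IsCyclotomic) (γ : Field.absoluteGaloisGroup ℚ) (_ : K.IsTopGenerator γ)
        (I : IwasawaH1Data W 7 K γ),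
        ∃ (F : GenusSeven.GenusFrame) (θu : ∀ n : ℕ, globalUnitsOf (F.layer n)), GenusSeven.IsNormedEllipticUnitFamily F θu ∧
          ∀ d : GenusSeven.GenusDatum F θu, ∃ Φ : GenusSeven.PinnedKatoGenusFrame W K hK I d,
            GenusSeven.IntegralComparisonShape Φ) ∧
    (Kato2004.exists_zetaClassPosition_of_rank_le_one → rank_eq_analyticRank_of_analyticRank_le_one →
    ∀ (W : WeierstrassCurve ℚ) [W.IsElliptic] [W.IsGloballyMinimal] [Fact (Nat.Prime 7)], X12.ClassCSeven W →
      letI : ContinuousSMul ℤ_[7] (W.tateModule 7) := TateModule.continuousSMul_padicInt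
      ∀ (K : ZpExtension ℚ 7) (hK : K.IsCyclotomic) (γ : Field.absoluteGaloisGroup ℚ) (_ : K.IsTopGenerator γ)
        (I : IwasawaH1Data W 7 K γ),
        ∃ (F : GenusSeven.GenusFrame) (θu : ∀ n : ℕ, globalUnitsOf (F.layer n)), GenusSeven.IsNormedEllipticUnitFamily F θu ∧
          ∀ d : GenusSeven.GenusDatum F θu, ∃ Φ : GenusSeven.PinnedKatoGenusFrame W K hK I d,
            GenusSeven.IntegralComparisonShape Φ) :=
  ⟨integralComparisonSeven_of_katoExpPadicInputs h, GenusSeven.integralComparisonSeven_of_katoExpInputs hv1⟩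

/-- **… and hence «K2cPinned» / the v11 letter `ResidueIsGenusUnitClassShape`** from the same input form over
`KatoExpPadicDatum` ((P3) `k2cPinned_of_integralComparison`).  CONDITIONAL; nothing asserted; 19945 OPEN.
[cite: Kato2004Asterisque, §15.16 (15.16.1) (p. 265)] -/
theorem k2cPinned_of_katoExpPadicInputs
    (h : exists_zetaClassPosition_of_rank_le_one → rank_eq_analyticRank_of_analyticRank_le_one →
      ∀ (W : WeierstrassCurve ℚ) [W.IsElliptic] [W.IsGloballyMinimal] [Fact (Nat.Prime 7)], X12.ClassCSeven W →
      letI : ContinuousSMul ℤ_[7] (W.tateModule 7) := TateModule.continuousSMul_padicInt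
      ∀ (K : ZpExtension ℚ 7) (hK : K.IsCyclotomic) (γ : Field.absoluteGaloisGroup ℚ) (hγ : K.IsTopGenerator γ)
        (I : IwasawaH1Data W 7 K γ),
        ∃ (F : GenusFrame) (θu : ∀ n : ℕ, globalUnitsOf (F.layer n)), IsNormedEllipticUnitFamily F θu ∧
          ∀ d : GenusDatum F θu, ∃ Φ : PinnedKatoGenusFrame W K hK I d, ∃ D : KatoExpPadicDatum hγ Φ,
            ∃ (t' : Φ.R) (m₀ : ℕ), Φ.t * t' = Φ.π ^ m₀ ∧
            (∀ (f : IwasawaAlgebra 7) (x : Φ.IK.H), f ≠ 0 → f • x = 0 → x = 0) ∧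
            (∀ x y : Φ.IK.H, ∃ s r₀ r₁ : IwasawaAlgebra 7,
              (s ≠ 0 ∨ r₀ ≠ 0 ∨ r₁ ≠ 0) ∧ s • x = r₀ • y + r₁ • Φ.piK y) ∧
            (∀ n : ℕ, ∃ χ : absoluteGaloisGroup Φ.Kcm →ₜ* ℂˣ,
              (∀ σ ∈ (K.restrictOfFinrankEqTwo (by decide) Φ.Kcm Φ.finrank_Kcm).layerSubgroup (n + 1), χ σ = 1) ∧
                IsPrimitiveRoot (((χ Φ.γK : ℂˣ)) : ℂ) (7 ^ (n + 1))) ∧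
            (∀ χ : absoluteGaloisGroup Φ.Kcm →ₜ* ℂˣ, ∃ Lf : ℂ → ℂ, CM.IsDepletedHeckeL Φ.ψ χ (7 * (7 * F.d)) Lf) ∧
            (∃ n₁ : ℕ, ∀ n : ℕ, n₁ ≤ n → ∀ χ : absoluteGaloisGroup Φ.Kcm →ₜ* ℂˣ,
              (∀ σ ∈ (K.restrictOfFinrankEqTwo (by decide) Φ.Kcm Φ.finrank_Kcm).layerSubgroup (n + 1), χ σ = 1) →
              IsPrimitiveRoot (((χ Φ.γK : ℂˣ)) : ℂ) (7 ^ (n + 1)) →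
              ∀ Lf : ℂ → ℂ, CM.IsDepletedHeckeL Φ.ψ χ (7 * (7 * F.d)) Lf → Lf 1 ≠ 0) ∧
            Φ.π ^ (m₀ + 2 * D.jα) ∣ D.cZ * t') :
    exists_zetaClassPosition_of_rank_le_one → rank_eq_analyticRank_of_analyticRank_le_one →
      ∀ (W : WeierstrassCurve ℚ) [W.IsElliptic] [W.IsGloballyMinimal] [Fact (Nat.Prime 7)], X12.ClassCSeven W →
      letI : ContinuousSMul ℤ_[7] (W.tateModule 7) := TateModule.continuousSMul_padicInt
      ∀ (K : ZpExtension ℚ 7) (hK : K.IsCyclotomic) (γ : Field.absoluteGaloisGroup ℚ) (_ : K.IsTopGenerator γ)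
        (I : IwasawaH1Data W 7 K γ),
        ∃ (F : GenusFrame) (θu : ∀ n : ℕ, globalUnitsOf (F.layer n)), IsNormedEllipticUnitFamily F θu ∧
          ∀ d : GenusDatum F θu, ∃ Φ : PinnedKatoGenusFrame W K hK I d,
            ResidueIsGenusUnitClassShape Φ.toKatoGenusFrame :=
  k2cPinned_of_integralComparison (integralComparisonSeven_of_katoExpPadicInputs h)

/-- **«K2cPinned» FROM (R3)-padic `KatoExpPadicCompatShape`, THE STRUCTURAL BINDERS AND THE DIVISIBILITY KERNEL**
(`rationalComparisonShape_of_katoExpPadicCompat` + (P3) `k2cPinned_of_rational_of_divisibility`; the statement of the tree's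
`k2cPinned_of_katoExpCompat_of_divisibility` with `KatoExpCompatShape ↦ KatoExpPadicCompatShape`).  CONDITIONAL; nothing
asserted; 19945 OPEN. [cite: Kato2004Asterisque, (15.16.1) (p. 265), Thm. 12.4 (2) (p. 221), Prop. 15.9 (p. 258)] -/
theorem k2cPinned_of_katoExpPadicCompat_of_divisibility
    (hRD : exists_zetaClassPosition_of_rank_le_one → rank_eq_analyticRank_of_analyticRank_le_one →
      ∀ (W : WeierstrassCurve ℚ) [W.IsElliptic] [W.IsGloballyMinimal] [Fact (Nat.Prime 7)], X12.ClassCSeven W →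
      letI : ContinuousSMul ℤ_[7] (W.tateModule 7) := TateModule.continuousSMul_padicInt
      ∀ (K : ZpExtension ℚ 7) (hK : K.IsCyclotomic) (γ : Field.absoluteGaloisGroup ℚ) (hγ : K.IsTopGenerator γ)
        (I : IwasawaH1Data W 7 K γ),
        ∃ (F : GenusFrame) (θu : ∀ n : ℕ, globalUnitsOf (F.layer n)), IsNormedEllipticUnitFamily F θu ∧
          ∀ d : GenusDatum F θu, ∃ Φ : PinnedKatoGenusFrame W K hK I d,
            KatoExpPadicCompatShape hγ Φ ∧
            (∃ (t' : Φ.R) (m₀ : ℕ), Φ.t * t' = Φ.π ^ m₀) ∧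
            (∀ (f : IwasawaAlgebra 7) (x : Φ.IK.H), f ≠ 0 → f • x = 0 → x = 0) ∧
            (∀ x y : Φ.IK.H, ∃ s r₀ r₁ : IwasawaAlgebra 7,
              (s ≠ 0 ∨ r₀ ≠ 0 ∨ r₁ ≠ 0) ∧ s • x = r₀ • y + r₁ • Φ.piK y) ∧
            (∀ n : ℕ, ∃ χ : absoluteGaloisGroup Φ.Kcm →ₜ* ℂˣ,
              (∀ σ ∈ (K.restrictOfFinrankEqTwo (by decide) Φ.Kcm Φ.finrank_Kcm).layerSubgroup (n + 1), χ σ = 1) ∧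
                IsPrimitiveRoot (((χ Φ.γK : ℂˣ)) : ℂ) (7 ^ (n + 1))) ∧
            (∀ χ : absoluteGaloisGroup Φ.Kcm →ₜ* ℂˣ, ∃ Lf : ℂ → ℂ, CM.IsDepletedHeckeL Φ.ψ χ (7 * (7 * F.d)) Lf) ∧
            (∃ n₁ : ℕ, ∀ n : ℕ, n₁ ≤ n → ∀ χ : absoluteGaloisGroup Φ.Kcm →ₜ* ℂˣ,
              (∀ σ ∈ (K.restrictOfFinrankEqTwo (by decide) Φ.Kcm Φ.finrank_Kcm).layerSubgroup (n + 1), χ σ = 1) →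
              IsPrimitiveRoot (((χ Φ.γK : ℂˣ)) : ℂ) (7 ^ (n + 1)) →
              ∀ Lf : ℂ → ℂ, CM.IsDepletedHeckeL Φ.ψ χ (7 * (7 * F.d)) Lf → Lf 1 ≠ 0) ∧
            ComparisonDivisibilityShape Φ) :
    exists_zetaClassPosition_of_rank_le_one → rank_eq_analyticRank_of_analyticRank_le_one →
      ∀ (W : WeierstrassCurve ℚ) [W.IsElliptic] [W.IsGloballyMinimal] [Fact (Nat.Prime 7)], X12.ClassCSeven W →
      letI : ContinuousSMul ℤ_[7] (W.tateModule 7) := TateModule.continuousSMul_padicInt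
      ∀ (K : ZpExtension ℚ 7) (hK : K.IsCyclotomic) (γ : Field.absoluteGaloisGroup ℚ) (_ : K.IsTopGenerator γ)
        (I : IwasawaH1Data W 7 K γ),
        ∃ (F : GenusFrame) (θu : ∀ n : ℕ, globalUnitsOf (F.layer n)), IsNormedEllipticUnitFamily F θu ∧
          ∀ d : GenusDatum F θu, ∃ Φ : PinnedKatoGenusFrame W K hK I d,
            ResidueIsGenusUnitClassShape Φ.toKatoGenusFrame := by
  refine k2cPinned_of_rational_of_divisibility fun hstar hGZK W _ _ _ hC K hK γ hγ I => ?_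
  haveI : ContinuousSMul ℤ_[7] (W.tateModule 7) := TateModule.continuousSMul_padicInt
  obtain ⟨F, θu, hpin, hΦ⟩ := hRD hstar hGZK W hC K hK γ hγ I
  refine ⟨F, θu, hpin, fun d => ?_⟩
  obtain ⟨Φ, hD, ht, htf, hrk, hχ, hL, hRoh, hDiv⟩ := hΦ d
  exact ⟨Φ, rationalComparisonShape_of_katoExpPadicCompat hγ Φ hD ht htf hrk hχ hL hRoh, hDiv⟩

/-! ## §G  (PK)-R over `KatoExpPadicDatum`: ★″ the integral comparison from the input form whose last conjunct is
`IsUnit Φ.t ∧ D.jα ≤ 2 * D.e + 2 * Φ.k + Φ.a` (pen D1086 (c3); `PeriodPositionField` UNFOLDED) -/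

/-- ★″ **`integralComparisonSeven_of_katoExpPadicPeriodPositionInputs`** — the statement of the tree's ★″
`GenusSeven.integralComparisonSeven_of_katoExpPeriodPositionInputs` with `KatoExpDatum ↦ KatoExpPadicDatum`: the input form's
last conjunct `Φ.π ^ (m₀ + 2 * D.jα) ∣ D.cZ * t′` replaced by `IsUnit Φ.t ∧ D.jα ≤ 2 * D.e + 2 * Φ.k + Φ.a`, SAME conclusion.
CONDITIONAL; nothing asserted; no stub closes; 19945 OPEN; BSD claimed for no curve.
[cite: Kato2004Asterisque, §15.16 (15.16.1) (p. 265), 15.14 (p. 264), Prop. 15.9 (p. 258), Thm. 12.4 (2) / 12.5 (1) (p. 221)] -/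
theorem integralComparisonSeven_of_katoExpPadicPeriodPositionInputs
    (h : exists_zetaClassPosition_of_rank_le_one → rank_eq_analyticRank_of_analyticRank_le_one →
      ∀ (W : WeierstrassCurve ℚ) [W.IsElliptic] [W.IsGloballyMinimal] [Fact (Nat.Prime 7)], X12.ClassCSeven W →
      letI : ContinuousSMul ℤ_[7] (W.tateModule 7) := TateModule.continuousSMul_padicInt
      ∀ (K : ZpExtension ℚ 7) (hK : K.IsCyclotomic) (γ : Field.absoluteGaloisGroup ℚ) (hγ : K.IsTopGenerator γ)
        (I : IwasawaH1Data W 7 K γ),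
        ∃ (F : GenusFrame) (θu : ∀ n : ℕ, globalUnitsOf (F.layer n)), IsNormedEllipticUnitFamily F θu ∧
          ∀ d : GenusDatum F θu, ∃ Φ : PinnedKatoGenusFrame W K hK I d, ∃ D : KatoExpPadicDatum hγ Φ,
            ∃ (t' : Φ.R) (m₀ : ℕ), Φ.t * t' = Φ.π ^ m₀ ∧
            (∀ (f : IwasawaAlgebra 7) (x : Φ.IK.H), f ≠ 0 → f • x = 0 → x = 0) ∧
            (∀ x y : Φ.IK.H, ∃ s r₀ r₁ : IwasawaAlgebra 7,
              (s ≠ 0 ∨ r₀ ≠ 0 ∨ r₁ ≠ 0) ∧ s • x = r₀ • y + r₁ • Φ.piK y) ∧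
            (∀ n : ℕ, ∃ χ : absoluteGaloisGroup Φ.Kcm →ₜ* ℂˣ,
              (∀ σ ∈ (K.restrictOfFinrankEqTwo (by decide) Φ.Kcm Φ.finrank_Kcm).layerSubgroup (n + 1), χ σ = 1) ∧
                IsPrimitiveRoot (((χ Φ.γK : ℂˣ)) : ℂ) (7 ^ (n + 1))) ∧
            (∀ χ : absoluteGaloisGroup Φ.Kcm →ₜ* ℂˣ, ∃ Lf : ℂ → ℂ, CM.IsDepletedHeckeL Φ.ψ χ (7 * (7 * F.d)) Lf) ∧
            (∃ n₁ : ℕ, ∀ n : ℕ, n₁ ≤ n → ∀ χ : absoluteGaloisGroup Φ.Kcm →ₜ* ℂˣ,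
              (∀ σ ∈ (K.restrictOfFinrankEqTwo (by decide) Φ.Kcm Φ.finrank_Kcm).layerSubgroup (n + 1), χ σ = 1) →
              IsPrimitiveRoot (((χ Φ.γK : ℂˣ)) : ℂ) (7 ^ (n + 1)) →
              ∀ Lf : ℂ → ℂ, CM.IsDepletedHeckeL Φ.ψ χ (7 * (7 * F.d)) Lf → Lf 1 ≠ 0) ∧
            IsUnit Φ.t ∧ D.jα ≤ 2 * D.e + 2 * Φ.k + Φ.a) :
    Kato2004.exists_zetaClassPosition_of_rank_le_one → rank_eq_analyticRank_of_analyticRank_le_one →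
    ∀ (W : WeierstrassCurve ℚ) [W.IsElliptic] [W.IsGloballyMinimal] [Fact (Nat.Prime 7)], X12.ClassCSeven W →
      letI : ContinuousSMul ℤ_[7] (W.tateModule 7) := TateModule.continuousSMul_padicInt
      ∀ (K : ZpExtension ℚ 7) (hK : K.IsCyclotomic) (γ : Field.absoluteGaloisGroup ℚ) (_ : K.IsTopGenerator γ)
        (I : IwasawaH1Data W 7 K γ),
        ∃ (F : GenusSeven.GenusFrame) (θu : ∀ n : ℕ, globalUnitsOf (F.layer n)), GenusSeven.IsNormedEllipticUnitFamily F θu ∧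
          ∀ d : GenusSeven.GenusDatum F θu, ∃ Φ : GenusSeven.PinnedKatoGenusFrame W K hK I d,
            GenusSeven.IntegralComparisonShape Φ := by
  intro hstar hGZK W _ _ _ hC K hK γ hγ I
  haveI : ContinuousSMul ℤ_[7] (W.tateModule 7) := TateModule.continuousSMul_padicInt
  obtain ⟨F, θu, hpin, hΦ⟩ := h hstar hGZK W hC K hK γ hγ I
  refine ⟨F, θu, hpin, fun d => ?_⟩
  obtain ⟨Φ, D, t', m₀, ht, htf, hrk, hχ, hL, hRoh, htu, hPP⟩ := hΦ d
  exact ⟨Φ, integralComparisonShape_of_katoExpPadicDatum_of_le hγ Φ D t' m₀ ht htf hrk hχ hL hRoh htu hPP⟩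

/-- ★″-At (general gauge): the input form's last conjunct replaced by `∃ w′ m′, t′ = w′·π^{m′} ∧ m₀ + jα ≤ 2e + 2k + a + m′`
(`PeriodPositionFieldAt` UNFOLDED), SAME conclusion.  CONDITIONAL; nothing asserted; no stub closes; 19945 OPEN.
[cite: Kato2004Asterisque, §15.16 (15.16.1) (p. 265), 15.14 (p. 264), Thm. 12.4 (2) (p. 221)] -/
theorem integralComparisonSeven_of_katoExpPadicPeriodPositionAtInputs
    (h : exists_zetaClassPosition_of_rank_le_one → rank_eq_analyticRank_of_analyticRank_le_one →
      ∀ (W : WeierstrassCurve ℚ) [W.IsElliptic] [W.IsGloballyMinimal] [Fact (Nat.Prime 7)], X12.ClassCSeven W →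
      letI : ContinuousSMul ℤ_[7] (W.tateModule 7) := TateModule.continuousSMul_padicInt
      ∀ (K : ZpExtension ℚ 7) (hK : K.IsCyclotomic) (γ : Field.absoluteGaloisGroup ℚ) (hγ : K.IsTopGenerator γ)
        (I : IwasawaH1Data W 7 K γ),
        ∃ (F : GenusFrame) (θu : ∀ n : ℕ, globalUnitsOf (F.layer n)), IsNormedEllipticUnitFamily F θu ∧
          ∀ d : GenusDatum F θu, ∃ Φ : PinnedKatoGenusFrame W K hK I d, ∃ D : KatoExpPadicDatum hγ Φ,
            ∃ (t' : Φ.R) (m₀ : ℕ), Φ.t * t' = Φ.π ^ m₀ ∧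
            (∀ (f : IwasawaAlgebra 7) (x : Φ.IK.H), f ≠ 0 → f • x = 0 → x = 0) ∧
            (∀ x y : Φ.IK.H, ∃ s r₀ r₁ : IwasawaAlgebra 7,
              (s ≠ 0 ∨ r₀ ≠ 0 ∨ r₁ ≠ 0) ∧ s • x = r₀ • y + r₁ • Φ.piK y) ∧
            (∀ n : ℕ, ∃ χ : absoluteGaloisGroup Φ.Kcm →ₜ* ℂˣ,
              (∀ σ ∈ (K.restrictOfFinrankEqTwo (by decide) Φ.Kcm Φ.finrank_Kcm).layerSubgroup (n + 1), χ σ = 1) ∧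
                IsPrimitiveRoot (((χ Φ.γK : ℂˣ)) : ℂ) (7 ^ (n + 1))) ∧
            (∀ χ : absoluteGaloisGroup Φ.Kcm →ₜ* ℂˣ, ∃ Lf : ℂ → ℂ, CM.IsDepletedHeckeL Φ.ψ χ (7 * (7 * F.d)) Lf) ∧
            (∃ n₁ : ℕ, ∀ n : ℕ, n₁ ≤ n → ∀ χ : absoluteGaloisGroup Φ.Kcm →ₜ* ℂˣ,
              (∀ σ ∈ (K.restrictOfFinrankEqTwo (by decide) Φ.Kcm Φ.finrank_Kcm).layerSubgroup (n + 1), χ σ = 1) →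
              IsPrimitiveRoot (((χ Φ.γK : ℂˣ)) : ℂ) (7 ^ (n + 1)) →
              ∀ Lf : ℂ → ℂ, CM.IsDepletedHeckeL Φ.ψ χ (7 * (7 * F.d)) Lf → Lf 1 ≠ 0) ∧
            ∃ (w' : Φ.R) (m' : ℕ), t' = w' * Φ.π ^ m' ∧ m₀ + D.jα ≤ 2 * D.e + 2 * Φ.k + Φ.a + m') :
    Kato2004.exists_zetaClassPosition_of_rank_le_one → rank_eq_analyticRank_of_analyticRank_le_one →
    ∀ (W : WeierstrassCurve ℚ) [W.IsElliptic] [W.IsGloballyMinimal] [Fact (Nat.Prime 7)], X12.ClassCSeven W →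
      letI : ContinuousSMul ℤ_[7] (W.tateModule 7) := TateModule.continuousSMul_padicInt
      ∀ (K : ZpExtension ℚ 7) (hK : K.IsCyclotomic) (γ : Field.absoluteGaloisGroup ℚ) (_ : K.IsTopGenerator γ)
        (I : IwasawaH1Data W 7 K γ),
        ∃ (F : GenusSeven.GenusFrame) (θu : ∀ n : ℕ, globalUnitsOf (F.layer n)), GenusSeven.IsNormedEllipticUnitFamily F θu ∧
          ∀ d : GenusSeven.GenusDatum F θu, ∃ Φ : GenusSeven.PinnedKatoGenusFrame W K hK I d,
            GenusSeven.IntegralComparisonShape Φ := by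
  intro hstar hGZK W _ _ _ hC K hK γ hγ I
  haveI : ContinuousSMul ℤ_[7] (W.tateModule 7) := TateModule.continuousSMul_padicInt
  obtain ⟨F, θu, hpin, hΦ⟩ := h hstar hGZK W hC K hK γ hγ I
  refine ⟨F, θu, hpin, fun d => ?_⟩
  obtain ⟨Φ, D, t', m₀, ht, htf, hrk, hχ, hL, hRoh, w', m', ht', hPP⟩ := hΦ d
  exact ⟨Φ, integralComparisonShape_of_katoExpPadicDatum_of_leAt hγ Φ D t' m₀ ht htf hrk hχ hL hRoh w' m' ht' hPP⟩

end Summit.BirchSwinnertonDyer.BirchSwinnertonDyer.Cruxes.EllipticUnitValueSevenOfGZK.K2C9R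

end
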